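import Literature.MathematicalPhysics.QuantumLattice.HubbardTTPrimeMeanEnergySupergradient
import HarnessLib

/-!
# Combination of `t–t'` window certificates with PER-CORNER energy multipliers and
# equation-of-motion generators: the covariance remainder (crew hubbard-algo, seat p2, T4′)

Cell hubbard-algo (seat p2, `HOME/hubbard-algo-p2/TARGET.md` device D1/D1′; written by that seat, landed verbatim by the lit seat); extends the
landed box certificate `HubbardTTPrimeWindowCertificateConvexComb` (T4), whose corners must SHARE the
energy multiplier `κ` and the eom family `B`. Here every corner `i` carries its own `κᵢ ≥ 0` and its
own eom generators `Bᵢₖ`; the price is a computable remainder on the shared word dictionary.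

Write `Φ(t,t',U) = Φ(t,t̄',Ū) + (t'−t̄') Φ(0,1,0) + (U−Ū) Φ(0,0,1)` (`hubbardTTPrimeFermionInteraction_taylor`),
`t̄' = Σ wᵢ t'ᵢ`, `Ū = Σ wᵢ Uᵢ`. Given θ-FREE expansions on the dictionary `word : κ'' → …`
  `Σₖ [H_{Λ'}(0,1,0), Γ Bᵢₖ] = Σₘ qtᵢₘ • w_m`, `Σₖ [H_{Λ'}(0,0,1), Γ Bᵢₖ] = Σₘ qUᵢₘ • w_m`,
  `Γ E_{Φ(0,1,0)} = Σₘ etₘ • w_m`, `Γ E_{Φ(0,0,1)} = Σₘ eUₘ • w_m`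
(finite identities in `𝔄_{Λ'}`, checkable by the certificate reader), the weighted sum of the corner
identities IS a window identity at the barycentre with constant
`c' = Σ wᵢcᵢ + (Σ wᵢκᵢuᵢ − κ̄ u')` (`κ̄ = Σ wᵢκᵢ`, ANY `u'`), Gram matrix `Σ wᵢ Λmᵢ`, eom generators
`B̄ₖ = Σ wᵢ Bᵢₖ`, and word coefficients `āₘ + Rₘ`,
  `Rₘ = Σᵢ wᵢ [ (t'ᵢ − t̄')(qtᵢₘ − κᵢ etₘ) + (Uᵢ − Ū)(qUᵢₘ − κᵢ eUₘ) ]`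
— a weighted COVARIANCE between the corner offsets and the corner duals' "coupling charges"
(`sum_smul_windowCertificates_TT'_eq`). One application of the tree theorem
`IsTorusLimitOf.re_sum_expect_d4_ge_of_window_certificate_TT'_ineq` at the barycentre then gives, for
every torus-limit ground state there with `e(t,t̄',Ū,n) ≤ u'`,
  `Σ wᵢcᵢ + (Σ wᵢκᵢuᵢ − κ̄u') − Σₘ ‖Σᵢ wᵢ aᵢₘ + Rₘ‖ + (Σ_σ Σᵢ wᵢ μᵢσ)(n/2 − ν) ≤ |S|⁻¹ Σ_γ Re ω(Γ X)`
(`…re_sum_expect_d4_ge_of_window_certificates_combination_TT'_ineq`, translation-only and weighted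
forms). With shared `κ`, `B` and `u' = Σ wᵢuᵢ` the remainder vanishes and T4 is recovered.
Everything is PROVED; no definition, no named fact, no numerical input.

## References

* X. Han, *Quantum many-body bootstrap*, arXiv:2006.06002 (2020), §2–§3. [cite: Han2020Bootstrap, §3]
* J. Wang et al., *Certifying ground-state properties of many-body systems*, PRX 14 (2024) 031006,
  §III. [cite: WangEtAl2024, §III]
* O. Bratteli, A. Kishimoto, D. W. Robinson, CMP 64 (1978) 41, §3. [cite: BratteliKishimotoRobinson1978, §3 (mean energy functional)]
-/

noncomputable section

namespace Literature.MathematicalPhysics.QuantumLattice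

open Matrix Finset HubbardWave0 Literature.Probability.LatticeModels ThermodynamicLimit
open Literature.MathematicalPhysics.QuantumManyBody.StateRelaxation
open _root_.Filter
open scoped _root_.Topology ComplexOrder BigOperators

/-! ### §1 First-order (exact) Taylor form of the `t–t'–U` interaction around a reference point -/

/-- `Φ(t,t',U) X = Φ(t,t'₀,U₀) X + (t'−t'₀) • Φ(0,1,0) X + (U−U₀) • Φ(0,0,1) X` (the interaction is
linear in the coupling vector). [cite: XuEtAl2024, eq. (1)] -/
theorem hubbardTTPrimeFermionInteraction_taylor (t tp U tp₀ U₀ : ℝ) (X : Finset (Site 2)) :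
    (hubbardTTPrimeFermionInteraction t tp U).Φ X =
      (hubbardTTPrimeFermionInteraction t tp₀ U₀).Φ X +
        ((tp - tp₀ : ℝ) : ℂ) • (hubbardTTPrimeFermionInteraction 0 1 0).Φ X +
        ((U - U₀ : ℝ) : ℂ) • (hubbardTTPrimeFermionInteraction 0 0 1).Φ X := by
  have e : hubbardTTPrimeFermionInteraction t tp U =
      hubbardTTPrimeFermionInteraction (t + (tp - tp₀) * 0 + (U - U₀) * 0)
        (tp₀ + (tp - tp₀) * 1 + (U - U₀) * 0) (U₀ + (tp - tp₀) * 0 + (U - U₀) * 1) := by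
    congr 1 <;> ring
  rw [e, hubbardTTPrimeFermionInteraction_add, hubbardTTPrimeFermionInteraction_add,
    hubbardTTPrimeFermionInteraction_smul, hubbardTTPrimeFermionInteraction_smul]

namespace FermionInteraction

variable {d : ℕ}

/-- Local Hamiltonians of `Ψ = Ψ₀ + c₁ Ψ₁ + c₂ Ψ₂` (pointwise). [cite: ArakiMoriya2003, §5.1 (local Hamiltonian H(I))] -/
theorem localHamiltonian_of_add_smul_smul {Ψ Ψ₀ Ψ₁ Ψ₂ : FermionInteraction d} {c₁ c₂ : ℂ}
    (h : ∀ X, Ψ.Φ X = Ψ₀.Φ X + c₁ • Ψ₁.Φ X + c₂ • Ψ₂.Φ X) (Λ : Finset (Site d)) :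
    Ψ.localHamiltonian Λ =
      Ψ₀.localHamiltonian Λ + c₁ • Ψ₁.localHamiltonian Λ + c₂ • Ψ₂.localHamiltonian Λ := by
  unfold localHamiltonian
  rw [Finset.smul_sum, Finset.smul_sum, ← Finset.sum_add_distrib, ← Finset.sum_add_distrib]
  exact Finset.sum_congr rfl fun X _ => by rw [h, map_add, map_add, map_smul, map_smul]

/-- Mean-energy observables of `Ψ = Ψ₀ + c₁ Ψ₁ + c₂ Ψ₂` (pointwise). [cite: BratteliKishimotoRobinson1978, §3 (mean energy functional)] -/
theorem meanEnergyObs_of_add_smul_smul {Ψ Ψ₀ Ψ₁ Ψ₂ : FermionInteraction d} {c₁ c₂ : ℂ}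
    (h : ∀ X, Ψ.Φ X = Ψ₀.Φ X + c₁ • Ψ₁.Φ X + c₂ • Ψ₂.Φ X) (R : ℝ) :
    Ψ.meanEnergyObs R =
      Ψ₀.meanEnergyObs R + c₁ • Ψ₁.meanEnergyObs R + c₂ • Ψ₂.meanEnergyObs R := by
  unfold meanEnergyObs
  rw [Finset.smul_sum, Finset.smul_sum, ← Finset.sum_add_distrib, ← Finset.sum_add_distrib]
  exact Finset.sum_congr rfl fun X _ => by
    rw [h, map_add, map_add, map_smul, map_smul, smul_add, smul_add, smul_comm _ c₁, smul_comm _ c₂]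

end FermionInteraction

/-- Commutators with `H + a • H₁ + b • H₂` split accordingly. [folklore] [cite: WangEtAl2024, §III] -/
theorem commutator_add_smul_smul_expand {Λ' : Finset (Site 2)} (H H₁ H₂ E : FermionOp Λ') (a b : ℂ) :
    (H + a • H₁ + b • H₂) * E - E * (H + a • H₁ + b • H₂) =
      (H * E - E * H) + a • (H₁ * E - E * H₁) + b • (H₂ * E - E * H₂) := by
  simp only [add_mul, mul_add, smul_mul_assoc, mul_smul_comm, smul_sub]
  abel

/-! ### §2 The weighted sum of corner certificates with per-corner `κᵢ` and `Bᵢ` -/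

/-- **Combination identity with covariance remainder.** Corner window identities at `(t'ᵢ, Uᵢ)`,
`i ∈ I`, sharing the objective `X`, `ν`, the Gram basis `O`, the symmetry data, the word lists and
the eom INDEX set `s`, with free `cᵢ, uᵢ, κᵢ, μᵢ, Λmᵢ, Bᵢ, Yᵢ, bᵢ, dcᵢ, aᵢ`; weights with `Σ wᵢ = 1`
(no sign needed here); θ-free expansions `hqt, hqU, het, heU` of the coupling derivatives of the
eom rows and of the energy row on the dictionary `word`. Then the weighted sum of the corner
identities is a window identity at the barycentre `(Σ wᵢ t'ᵢ, Σ wᵢ Uᵢ)` with constant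
`Σ wᵢcᵢ + (Σ wᵢκᵢuᵢ − (Σ wᵢκᵢ) u')` (any `u'`), multiplier `Σ wᵢκᵢ`, Gram matrix `Σ wᵢ Λmᵢ`, eom
generators `Σ wᵢ Bᵢₖ`, and word coefficients `Σ wᵢ aᵢₘ + Rₘ`,
`Rₘ = Σᵢ wᵢ [ (t'ᵢ − t̄')(qtᵢₘ − κᵢ etₘ) + (Uᵢ − Ū)(qUᵢₘ − κᵢ eUₘ) ]`. [cite: Han2020Bootstrap, §3] -/
theorem sum_smul_windowCertificates_TT'_eq
    (t : ℝ) {ι₀ : Type*} (I : Finset ι₀) (w : ι₀ → ℝ) (hw1 : ∑ i ∈ I, w i = 1)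
    (tp U u c κ : ι₀ → ℝ) (u' : ℝ)
    {Λ Λ' : Finset (Site 2)} (hΛ : Λ ⊆ Λ') (h0 : thicken ({0} : Finset (Site 2)) 1 ⊆ Λ')
    (hz : (0 : Site 2) ∈ Λ')
    (Xw : FermionOp Λ') (μ : ι₀ → Fin 2 → ℝ) (ν : ℝ)
    {m : Type*} [Fintype m] [DecidableEq m] (Λm : ι₀ → Matrix m m ℂ) (O : m → FermionOp Λ')
    {κ' : Type*} (s : Finset κ') (B : ι₀ → κ' → FermionOp Λ)
    {ι : Type*} (tt : Finset ι) (γ : ι → DihedralGroup 4) (wv : ι → Site 2)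
    (hsh : ∀ l, d4ShiftSet (γ l) (wv l) Λ ⊆ Λ') (Y : ι₀ → ι → FermionOp Λ)
    {ρ : Type*} (uu : Finset ρ) (b : ι₀ → ρ → ℂ) (cw : ρ → List (Orb (PolySite Λ') × Bool))
    {δ : Type*} (ah : Finset δ) (dc : ι₀ → δ → ℝ) (V : δ → FermionOp Λ')
    {κ'' : Type*} (wd : Finset κ'') (a : ι₀ → κ'' → ℂ)
    (word : κ'' → List (Orb (PolySite Λ') × Bool))
    (qt qU : ι₀ → κ'' → ℂ) (et eU : κ'' → ℂ)
    (hqt : ∀ i ∈ I, ∑ k ∈ s, ((hubbardTTPrimeFermionInteraction 0 1 0).localHamiltonian Λ' *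
          fermionEmbed (PolySite.incl hΛ) (B i k) -
        fermionEmbed (PolySite.incl hΛ) (B i k) *
          (hubbardTTPrimeFermionInteraction 0 1 0).localHamiltonian Λ') =
      ∑ k ∈ wd, qt i k • ladderWord (word k))
    (hqU : ∀ i ∈ I, ∑ k ∈ s, ((hubbardTTPrimeFermionInteraction 0 0 1).localHamiltonian Λ' *
          fermionEmbed (PolySite.incl hΛ) (B i k) -
        fermionEmbed (PolySite.incl hΛ) (B i k) *
          (hubbardTTPrimeFermionInteraction 0 0 1).localHamiltonian Λ') =
      ∑ k ∈ wd, qU i k • ladderWord (word k))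
    (het : fermionEmbed (PolySite.incl h0) ((hubbardTTPrimeFermionInteraction 0 1 0).meanEnergyObs 1) =
      ∑ k ∈ wd, et k • ladderWord (word k))
    (heU : fermionEmbed (PolySite.incl h0) ((hubbardTTPrimeFermionInteraction 0 0 1).meanEnergyObs 1) =
      ∑ k ∈ wd, eU k • ladderWord (word k))
    (hcert : ∀ i ∈ I, Xw - ((c i : ℝ) : ℂ) • (1 : FermionOp Λ') -
        ∑ σ : Fin 2, ((μ i σ : ℝ) : ℂ) • (nAt 0 hz σ - ((ν : ℝ) : ℂ) • (1 : FermionOp Λ')) -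
        ((κ i : ℝ) : ℂ) • (((u i : ℝ) : ℂ) • (1 : FermionOp Λ') -
          fermionEmbed (PolySite.incl h0)
            ((hubbardTTPrimeFermionInteraction t (tp i) (U i)).meanEnergyObs 1)) =
      gramForm (Λm i) O +
        (∑ k ∈ s, ((hubbardTTPrimeFermionInteraction t (tp i) (U i)).localHamiltonian Λ' *
              fermionEmbed (PolySite.incl hΛ) (B i k) -
            fermionEmbed (PolySite.incl hΛ) (B i k) *
              (hubbardTTPrimeFermionInteraction t (tp i) (U i)).localHamiltonian Λ') +
          ∑ l ∈ tt, (fermionEmbed (PolySite.incl (hsh l))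
              (fermionEmbed (PolySite.d4Emb (γ l) (wv l) Λ) (Y i l)) -
            fermionEmbed (PolySite.incl hΛ) (Y i l)) +
          ∑ j ∈ uu, b i j • ladderWord (cw j)) +
        (∑ m' ∈ ah, ((dc i m' : ℝ) : ℂ) • ((V m')ᴴ - V m') + ∑ k ∈ wd, a i k • ladderWord (word k))) :
    Xw - (((∑ i ∈ I, w i * c i + (∑ i ∈ I, w i * (κ i * u i) - (∑ i ∈ I, w i * κ i) * u') : ℝ)) : ℂ) •
          (1 : FermionOp Λ') -
        ∑ σ : Fin 2, (((∑ i ∈ I, w i * μ i σ : ℝ)) : ℂ) •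
          (nAt 0 hz σ - ((ν : ℝ) : ℂ) • (1 : FermionOp Λ')) -
        (((∑ i ∈ I, w i * κ i : ℝ)) : ℂ) • (((u' : ℝ) : ℂ) • (1 : FermionOp Λ') -
          fermionEmbed (PolySite.incl h0)
            ((hubbardTTPrimeFermionInteraction t (∑ i ∈ I, w i * tp i)
              (∑ i ∈ I, w i * U i)).meanEnergyObs 1)) =
      gramForm (∑ i ∈ I, ((w i : ℝ) : ℂ) • Λm i) O +
        (∑ k ∈ s, ((hubbardTTPrimeFermionInteraction t (∑ i ∈ I, w i * tp i)
                (∑ i ∈ I, w i * U i)).localHamiltonian Λ' *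
              fermionEmbed (PolySite.incl hΛ) (∑ i ∈ I, ((w i : ℝ) : ℂ) • B i k) -
            fermionEmbed (PolySite.incl hΛ) (∑ i ∈ I, ((w i : ℝ) : ℂ) • B i k) *
              (hubbardTTPrimeFermionInteraction t (∑ i ∈ I, w i * tp i)
                (∑ i ∈ I, w i * U i)).localHamiltonian Λ') +
          ∑ l ∈ tt, (fermionEmbed (PolySite.incl (hsh l))
              (fermionEmbed (PolySite.d4Emb (γ l) (wv l) Λ) (∑ i ∈ I, ((w i : ℝ) : ℂ) • Y i l)) -
            fermionEmbed (PolySite.incl hΛ) (∑ i ∈ I, ((w i : ℝ) : ℂ) • Y i l)) +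
          ∑ j ∈ uu, (∑ i ∈ I, ((w i : ℝ) : ℂ) * b i j) • ladderWord (cw j)) +
        (∑ m' ∈ ah, (((∑ i ∈ I, w i * dc i m' : ℝ)) : ℂ) • ((V m')ᴴ - V m') +
          ∑ k ∈ wd, (∑ i ∈ I, ((w i : ℝ) : ℂ) * a i k +
            ∑ i ∈ I, ((w i : ℝ) : ℂ) *
              ((((tp i - ∑ j ∈ I, w j * tp j : ℝ)) : ℂ) * (qt i k - ((κ i : ℝ) : ℂ) * et k) +
                (((U i - ∑ j ∈ I, w j * U j : ℝ)) : ℂ) * (qU i k - ((κ i : ℝ) : ℂ) * eU k))) •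
            ladderWord (word k)) := by
  -- shorthand for the barycentre, the coupling directions and the corner objects
  set Φb := hubbardTTPrimeFermionInteraction t (∑ i ∈ I, w i * tp i) (∑ i ∈ I, w i * U i) with hΦb
  set Ht : FermionOp Λ' := (hubbardTTPrimeFermionInteraction 0 1 0).localHamiltonian Λ' with hHt
  set HU : FermionOp Λ' := (hubbardTTPrimeFermionInteraction 0 0 1).localHamiltonian Λ' with hHU
  set Et : FermionOp (thicken ({0} : Finset (Site 2)) 1) :=
    (hubbardTTPrimeFermionInteraction 0 1 0).meanEnergyObs 1 with hEt
  set EU : FermionOp (thicken ({0} : Finset (Site 2)) 1) :=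
    (hubbardTTPrimeFermionInteraction 0 0 1).meanEnergyObs 1 with hEU
  set Hi : ι₀ → FermionOp Λ' := fun i =>
    (hubbardTTPrimeFermionInteraction t (tp i) (U i)).localHamiltonian Λ' with hHi
  set Ei : ι₀ → FermionOp (thicken ({0} : Finset (Site 2)) 1) := fun i =>
    (hubbardTTPrimeFermionInteraction t (tp i) (U i)).meanEnergyObs 1 with hEi
  set K : FermionOp Λ' :=
    Xw - (((∑ i ∈ I, w i * c i + (∑ i ∈ I, w i * (κ i * u i) - (∑ i ∈ I, w i * κ i) * u') : ℝ)) : ℂ) •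
          (1 : FermionOp Λ') -
        ∑ σ : Fin 2, (((∑ i ∈ I, w i * μ i σ : ℝ)) : ℂ) •
          (nAt 0 hz σ - ((ν : ℝ) : ℂ) • (1 : FermionOp Λ')) -
        (((∑ i ∈ I, w i * κ i : ℝ)) : ℂ) • (((u' : ℝ) : ℂ) • (1 : FermionOp Λ') -
          fermionEmbed (PolySite.incl h0) (Φb.meanEnergyObs 1)) with hK
  -- the corner objects around the barycentre
  have hΦi : ∀ i X, (hubbardTTPrimeFermionInteraction t (tp i) (U i)).Φ X =
      Φb.Φ X + ((tp i - ∑ j ∈ I, w j * tp j : ℝ) : ℂ) • (hubbardTTPrimeFermionInteraction 0 1 0).Φ X +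
        ((U i - ∑ j ∈ I, w j * U j : ℝ) : ℂ) • (hubbardTTPrimeFermionInteraction 0 0 1).Φ X :=
    fun i X => hubbardTTPrimeFermionInteraction_taylor t (tp i) (U i) _ _ X
  have hHi' : ∀ i, Hi i = Φb.localHamiltonian Λ' + ((tp i - ∑ j ∈ I, w j * tp j : ℝ) : ℂ) • Ht +
      ((U i - ∑ j ∈ I, w j * U j : ℝ) : ℂ) • HU :=
    fun i => FermionInteraction.localHamiltonian_of_add_smul_smul (hΦi i) Λ'
  have hEi' : ∀ i, Ei i = Φb.meanEnergyObs 1 + ((tp i - ∑ j ∈ I, w j * tp j : ℝ) : ℂ) • Et +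
      ((U i - ∑ j ∈ I, w j * U j : ℝ) : ℂ) • EU :=
    fun i => FermionInteraction.meanEnergyObs_of_add_smul_smul (hΦi i) 1
  have hw1C : ∑ i ∈ I, ((w i : ℝ) : ℂ) = 1 := by
    rw [← Complex.ofReal_sum, hw1, Complex.ofReal_one]
  -- §A the left-hand sides combine to `K` plus the two energy-direction corrections
  have hl : ∑ i ∈ I, ((w i : ℝ) : ℂ) • (Xw - ((c i : ℝ) : ℂ) • (1 : FermionOp Λ') -
        ∑ σ : Fin 2, ((μ i σ : ℝ) : ℂ) • (nAt 0 hz σ - ((ν : ℝ) : ℂ) • (1 : FermionOp Λ')) -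
        ((κ i : ℝ) : ℂ) • (((u i : ℝ) : ℂ) • (1 : FermionOp Λ') - fermionEmbed (PolySite.incl h0) (Ei i))) =
      K + (∑ i ∈ I, ((w i : ℝ) : ℂ) * (((κ i : ℝ) : ℂ) * ((tp i - ∑ j ∈ I, w j * tp j : ℝ) : ℂ))) •
          fermionEmbed (PolySite.incl h0) Et +
        (∑ i ∈ I, ((w i : ℝ) : ℂ) * (((κ i : ℝ) : ℂ) * ((U i - ∑ j ∈ I, w j * U j : ℝ) : ℂ))) •
          fermionEmbed (PolySite.incl h0) EU := by
    have P1 : ∑ i ∈ I, ((w i : ℝ) : ℂ) • Xw = Xw := by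
      rw [← Finset.sum_smul, hw1C, one_smul]
    have P2 : ∑ i ∈ I, ((w i : ℝ) : ℂ) • (((c i : ℝ) : ℂ) • (1 : FermionOp Λ')) =
        (∑ i ∈ I, ((w i : ℝ) : ℂ) * ((c i : ℝ) : ℂ)) • (1 : FermionOp Λ') := by
      simp_rw [smul_smul]
      rw [← Finset.sum_smul]
    have P3 : ∑ i ∈ I, ((w i : ℝ) : ℂ) •
          ∑ σ : Fin 2, ((μ i σ : ℝ) : ℂ) • (nAt 0 hz σ - ((ν : ℝ) : ℂ) • (1 : FermionOp Λ')) =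
        ∑ σ : Fin 2, (((∑ i ∈ I, w i * μ i σ : ℝ)) : ℂ) •
          (nAt 0 hz σ - ((ν : ℝ) : ℂ) • (1 : FermionOp Λ')) := by
      simp_rw [Finset.smul_sum, smul_smul]
      rw [Finset.sum_comm]
      refine Finset.sum_congr rfl fun σ _ => ?_
      rw [← Finset.sum_smul, Complex.ofReal_sum]
      simp_rw [Complex.ofReal_mul]
    have P4 : ∑ i ∈ I, ((w i : ℝ) : ℂ) • (((κ i : ℝ) : ℂ) •
          (((u i : ℝ) : ℂ) • (1 : FermionOp Λ') - fermionEmbed (PolySite.incl h0) (Ei i))) =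
        (∑ i ∈ I, ((w i : ℝ) : ℂ) * (((κ i : ℝ) : ℂ) * ((u i : ℝ) : ℂ))) • (1 : FermionOp Λ') -
          (∑ i ∈ I, ((w i : ℝ) : ℂ) * ((κ i : ℝ) : ℂ)) • fermionEmbed (PolySite.incl h0) (Φb.meanEnergyObs 1) -
          (∑ i ∈ I, ((w i : ℝ) : ℂ) * (((κ i : ℝ) : ℂ) * ((tp i - ∑ j ∈ I, w j * tp j : ℝ) : ℂ))) •
            fermionEmbed (PolySite.incl h0) Et -
          (∑ i ∈ I, ((w i : ℝ) : ℂ) * (((κ i : ℝ) : ℂ) * ((U i - ∑ j ∈ I, w j * U j : ℝ) : ℂ))) •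
            fermionEmbed (PolySite.incl h0) EU := by
      have e : ∀ i ∈ I, ((w i : ℝ) : ℂ) • (((κ i : ℝ) : ℂ) •
            (((u i : ℝ) : ℂ) • (1 : FermionOp Λ') - fermionEmbed (PolySite.incl h0) (Ei i))) =
          (((w i : ℝ) : ℂ) * (((κ i : ℝ) : ℂ) * ((u i : ℝ) : ℂ))) • (1 : FermionOp Λ') -
            (((w i : ℝ) : ℂ) * ((κ i : ℝ) : ℂ)) • fermionEmbed (PolySite.incl h0) (Φb.meanEnergyObs 1) -
            (((w i : ℝ) : ℂ) * (((κ i : ℝ) : ℂ) * ((tp i - ∑ j ∈ I, w j * tp j : ℝ) : ℂ))) •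
              fermionEmbed (PolySite.incl h0) Et -
            (((w i : ℝ) : ℂ) * (((κ i : ℝ) : ℂ) * ((U i - ∑ j ∈ I, w j * U j : ℝ) : ℂ))) •
              fermionEmbed (PolySite.incl h0) EU := by
        intro i _
        rw [hEi' i, map_add, map_add, map_smul, map_smul]
        module
      rw [Finset.sum_congr rfl e, Finset.sum_sub_distrib, Finset.sum_sub_distrib,
        Finset.sum_sub_distrib, ← Finset.sum_smul, ← Finset.sum_smul, ← Finset.sum_smul,
        ← Finset.sum_smul]
    have hdist : ∀ i ∈ I, ((w i : ℝ) : ℂ) • (Xw - ((c i : ℝ) : ℂ) • (1 : FermionOp Λ') -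
          ∑ σ : Fin 2, ((μ i σ : ℝ) : ℂ) • (nAt 0 hz σ - ((ν : ℝ) : ℂ) • (1 : FermionOp Λ')) -
          ((κ i : ℝ) : ℂ) • (((u i : ℝ) : ℂ) • (1 : FermionOp Λ') - fermionEmbed (PolySite.incl h0) (Ei i))) =
        ((w i : ℝ) : ℂ) • Xw - ((w i : ℝ) : ℂ) • (((c i : ℝ) : ℂ) • (1 : FermionOp Λ')) -
          ((w i : ℝ) : ℂ) • ∑ σ : Fin 2, ((μ i σ : ℝ) : ℂ) • (nAt 0 hz σ - ((ν : ℝ) : ℂ) • (1 : FermionOp Λ')) -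
          ((w i : ℝ) : ℂ) • (((κ i : ℝ) : ℂ) •
            (((u i : ℝ) : ℂ) • (1 : FermionOp Λ') - fermionEmbed (PolySite.incl h0) (Ei i))) := by
      intro i _
      rw [smul_sub, smul_sub, smul_sub]
    rw [Finset.sum_congr rfl hdist, Finset.sum_sub_distrib, Finset.sum_sub_distrib,
      Finset.sum_sub_distrib, P1, P2, P3, P4, hK]
    push_cast
    module
  -- §B the right-hand sides combine; the eom rows leave the word remainder `Q`
  have Q2a : ∀ i ∈ I, ∑ k ∈ s, (Hi i * fermionEmbed (PolySite.incl hΛ) (B i k) -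
        fermionEmbed (PolySite.incl hΛ) (B i k) * Hi i) =
      ∑ k ∈ s, (Φb.localHamiltonian Λ' * fermionEmbed (PolySite.incl hΛ) (B i k) -
        fermionEmbed (PolySite.incl hΛ) (B i k) * Φb.localHamiltonian Λ') +
      ∑ k ∈ wd, (((tp i - ∑ j ∈ I, w j * tp j : ℝ) : ℂ) * qt i k +
        ((U i - ∑ j ∈ I, w j * U j : ℝ) : ℂ) * qU i k) • ladderWord (word k) := by
    intro i hi
    rw [hHi' i]
    simp_rw [commutator_add_smul_smul_expand]
    rw [Finset.sum_add_distrib, Finset.sum_add_distrib, ← Finset.smul_sum, ← Finset.smul_sum,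
      hqt i hi, hqU i hi, Finset.smul_sum, Finset.smul_sum, add_assoc, ← Finset.sum_add_distrib]
    congr 1
    exact Finset.sum_congr rfl fun k _ => by rw [smul_smul, smul_smul, ← add_smul]
  have hr : ∑ i ∈ I, ((w i : ℝ) : ℂ) • (gramForm (Λm i) O +
        (∑ k ∈ s, (Hi i * fermionEmbed (PolySite.incl hΛ) (B i k) -
            fermionEmbed (PolySite.incl hΛ) (B i k) * Hi i) +
          ∑ l ∈ tt, (fermionEmbed (PolySite.incl (hsh l))
              (fermionEmbed (PolySite.d4Emb (γ l) (wv l) Λ) (Y i l)) -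
            fermionEmbed (PolySite.incl hΛ) (Y i l)) +
          ∑ j ∈ uu, b i j • ladderWord (cw j)) +
        (∑ m' ∈ ah, ((dc i m' : ℝ) : ℂ) • ((V m')ᴴ - V m') + ∑ k ∈ wd, a i k • ladderWord (word k))) =
      gramForm (∑ i ∈ I, ((w i : ℝ) : ℂ) • Λm i) O +
        (∑ k ∈ s, (Φb.localHamiltonian Λ' * fermionEmbed (PolySite.incl hΛ) (∑ i ∈ I, ((w i : ℝ) : ℂ) • B i k) -
            fermionEmbed (PolySite.incl hΛ) (∑ i ∈ I, ((w i : ℝ) : ℂ) • B i k) * Φb.localHamiltonian Λ') +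
          ∑ l ∈ tt, (fermionEmbed (PolySite.incl (hsh l))
              (fermionEmbed (PolySite.d4Emb (γ l) (wv l) Λ) (∑ i ∈ I, ((w i : ℝ) : ℂ) • Y i l)) -
            fermionEmbed (PolySite.incl hΛ) (∑ i ∈ I, ((w i : ℝ) : ℂ) • Y i l)) +
          ∑ j ∈ uu, (∑ i ∈ I, ((w i : ℝ) : ℂ) * b i j) • ladderWord (cw j)) +
        (∑ m' ∈ ah, (((∑ i ∈ I, w i * dc i m' : ℝ)) : ℂ) • ((V m')ᴴ - V m') +
          ∑ k ∈ wd, (∑ i ∈ I, ((w i : ℝ) : ℂ) * a i k) • ladderWord (word k)) +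
        ∑ k ∈ wd, (∑ i ∈ I, ((w i : ℝ) : ℂ) * (((tp i - ∑ j ∈ I, w j * tp j : ℝ) : ℂ) * qt i k +
          ((U i - ∑ j ∈ I, w j * U j : ℝ) : ℂ) * qU i k)) • ladderWord (word k) := by
    -- linearity of `gramForm` in the Gram matrix (the tree's `gramForm_sum_smul`, sibling file
    -- `HubbardTTPrimeWindowCertificateConvexComb`; re-derived locally to keep this file's imports minimal)
    have Q1 : ∑ i ∈ I, ((w i : ℝ) : ℂ) • gramForm (Λm i) O =
        gramForm (∑ i ∈ I, ((w i : ℝ) : ℂ) • Λm i) O := by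
      symm
      unfold gramForm
      have hL : ∀ a b : m, (∑ i ∈ I, ((w i : ℝ) : ℂ) • Λm i) a b • (star (O a) * O b) =
          ∑ i ∈ I, ((w i : ℝ) : ℂ) • (Λm i a b • (star (O a) * O b)) := by
        intro a b
        rw [Matrix.sum_apply, Finset.sum_smul]
        exact Finset.sum_congr rfl fun i _ => by rw [Matrix.smul_apply, smul_eq_mul, mul_smul]
      have hR : ∀ i : ι₀, ((w i : ℝ) : ℂ) • ∑ a : m, ∑ b : m, Λm i a b • (star (O a) * O b) =
          ∑ a : m, ∑ b : m, ((w i : ℝ) : ℂ) • (Λm i a b • (star (O a) * O b)) := by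
        intro i
        rw [Finset.smul_sum]
        exact Finset.sum_congr rfl fun a _ => Finset.smul_sum
      simp_rw [hL, hR]
      symm
      rw [Finset.sum_comm]
      refine Finset.sum_congr rfl fun a _ => ?_
      rw [Finset.sum_comm]
    have Q2 : ∑ i ∈ I, ((w i : ℝ) : ℂ) • ∑ k ∈ s, (Hi i * fermionEmbed (PolySite.incl hΛ) (B i k) -
          fermionEmbed (PolySite.incl hΛ) (B i k) * Hi i) =
        ∑ k ∈ s, (Φb.localHamiltonian Λ' * fermionEmbed (PolySite.incl hΛ) (∑ i ∈ I, ((w i : ℝ) : ℂ) • B i k) -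
          fermionEmbed (PolySite.incl hΛ) (∑ i ∈ I, ((w i : ℝ) : ℂ) • B i k) * Φb.localHamiltonian Λ') +
        ∑ k ∈ wd, (∑ i ∈ I, ((w i : ℝ) : ℂ) * (((tp i - ∑ j ∈ I, w j * tp j : ℝ) : ℂ) * qt i k +
          ((U i - ∑ j ∈ I, w j * U j : ℝ) : ℂ) * qU i k)) • ladderWord (word k) := by
      rw [Finset.sum_congr rfl fun i hi => by rw [Q2a i hi]]
      simp_rw [smul_add]
      rw [Finset.sum_add_distrib]
      congr 1
      · simp_rw [Finset.smul_sum]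
        rw [Finset.sum_comm]
        refine Finset.sum_congr rfl fun k _ => ?_
        rw [map_sum, Finset.mul_sum, Finset.sum_mul, ← Finset.sum_sub_distrib]
        refine Finset.sum_congr rfl fun i _ => ?_
        rw [map_smul, smul_sub, mul_smul_comm, smul_mul_assoc]
      · simp_rw [Finset.smul_sum, smul_smul]
        rw [Finset.sum_comm]
        exact Finset.sum_congr rfl fun k _ => by rw [Finset.sum_smul]
    have Q3 : ∑ i ∈ I, ((w i : ℝ) : ℂ) • ∑ l ∈ tt, (fermionEmbed (PolySite.incl (hsh l))
          (fermionEmbed (PolySite.d4Emb (γ l) (wv l) Λ) (Y i l)) - fermionEmbed (PolySite.incl hΛ) (Y i l)) =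
        ∑ l ∈ tt, (fermionEmbed (PolySite.incl (hsh l))
          (fermionEmbed (PolySite.d4Emb (γ l) (wv l) Λ) (∑ i ∈ I, ((w i : ℝ) : ℂ) • Y i l)) -
          fermionEmbed (PolySite.incl hΛ) (∑ i ∈ I, ((w i : ℝ) : ℂ) • Y i l)) := by
      simp_rw [Finset.smul_sum]
      rw [Finset.sum_comm]
      refine Finset.sum_congr rfl fun l _ => ?_
      simp_rw [smul_sub]
      rw [Finset.sum_sub_distrib, map_sum, map_sum, map_sum]
      congr 1
      · exact Finset.sum_congr rfl fun i _ => by rw [map_smul, map_smul]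
      · exact Finset.sum_congr rfl fun i _ => by rw [map_smul]
    have Q4 : ∑ i ∈ I, ((w i : ℝ) : ℂ) • ∑ j ∈ uu, b i j • ladderWord (cw j) =
        ∑ j ∈ uu, (∑ i ∈ I, ((w i : ℝ) : ℂ) * b i j) • ladderWord (cw j) := by
      simp_rw [Finset.smul_sum, smul_smul]
      rw [Finset.sum_comm]
      exact Finset.sum_congr rfl fun j _ => by rw [Finset.sum_smul]
    have Q5 : ∑ i ∈ I, ((w i : ℝ) : ℂ) • ∑ m' ∈ ah, ((dc i m' : ℝ) : ℂ) • ((V m')ᴴ - V m') =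
        ∑ m' ∈ ah, (((∑ i ∈ I, w i * dc i m' : ℝ)) : ℂ) • ((V m')ᴴ - V m') := by
      simp_rw [Finset.smul_sum, smul_smul]
      rw [Finset.sum_comm]
      refine Finset.sum_congr rfl fun m' _ => ?_
      rw [← Finset.sum_smul, Complex.ofReal_sum]
      simp_rw [Complex.ofReal_mul]
    have Q6 : ∑ i ∈ I, ((w i : ℝ) : ℂ) • ∑ k ∈ wd, a i k • ladderWord (word k) =
        ∑ k ∈ wd, (∑ i ∈ I, ((w i : ℝ) : ℂ) * a i k) • ladderWord (word k) := by
      simp_rw [Finset.smul_sum, smul_smul]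
      rw [Finset.sum_comm]
      exact Finset.sum_congr rfl fun k _ => by rw [Finset.sum_smul]
    simp only [smul_add, Finset.sum_add_distrib]
    rw [Q1, Q2, Q3, Q4, Q5, Q6]
    abel
  -- §C the combined identity; fold the corrections into the word column
  have hs : ∑ i ∈ I, ((w i : ℝ) : ℂ) • (Xw - ((c i : ℝ) : ℂ) • (1 : FermionOp Λ') -
        ∑ σ : Fin 2, ((μ i σ : ℝ) : ℂ) • (nAt 0 hz σ - ((ν : ℝ) : ℂ) • (1 : FermionOp Λ')) -
        ((κ i : ℝ) : ℂ) • (((u i : ℝ) : ℂ) • (1 : FermionOp Λ') - fermionEmbed (PolySite.incl h0) (Ei i))) =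
      ∑ i ∈ I, ((w i : ℝ) : ℂ) • (gramForm (Λm i) O +
        (∑ k ∈ s, (Hi i * fermionEmbed (PolySite.incl hΛ) (B i k) -
            fermionEmbed (PolySite.incl hΛ) (B i k) * Hi i) +
          ∑ l ∈ tt, (fermionEmbed (PolySite.incl (hsh l))
              (fermionEmbed (PolySite.d4Emb (γ l) (wv l) Λ) (Y i l)) -
            fermionEmbed (PolySite.incl hΛ) (Y i l)) +
          ∑ j ∈ uu, b i j • ladderWord (cw j)) +
        (∑ m' ∈ ah, ((dc i m' : ℝ) : ℂ) • ((V m')ᴴ - V m') + ∑ k ∈ wd, a i k • ladderWord (word k))) :=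
    Finset.sum_congr rfl fun i hi => by rw [hcert i hi]
  rw [hl, hr] at hs
  have hsplit : ∑ k ∈ wd, (∑ i ∈ I, ((w i : ℝ) : ℂ) * a i k +
        ∑ i ∈ I, ((w i : ℝ) : ℂ) *
          ((((tp i - ∑ j ∈ I, w j * tp j : ℝ)) : ℂ) * (qt i k - ((κ i : ℝ) : ℂ) * et k) +
            (((U i - ∑ j ∈ I, w j * U j : ℝ)) : ℂ) * (qU i k - ((κ i : ℝ) : ℂ) * eU k))) •
        ladderWord (word k) =
      ∑ k ∈ wd, (∑ i ∈ I, ((w i : ℝ) : ℂ) * a i k) • ladderWord (word k) +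
        (∑ k ∈ wd, (∑ i ∈ I, ((w i : ℝ) : ℂ) * (((tp i - ∑ j ∈ I, w j * tp j : ℝ) : ℂ) * qt i k +
            ((U i - ∑ j ∈ I, w j * U j : ℝ) : ℂ) * qU i k)) • ladderWord (word k) -
          (∑ i ∈ I, ((w i : ℝ) : ℂ) * (((κ i : ℝ) : ℂ) * ((tp i - ∑ j ∈ I, w j * tp j : ℝ) : ℂ))) •
            fermionEmbed (PolySite.incl h0) Et -
          (∑ i ∈ I, ((w i : ℝ) : ℂ) * (((κ i : ℝ) : ℂ) * ((U i - ∑ j ∈ I, w j * U j : ℝ) : ℂ))) •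
            fermionEmbed (PolySite.incl h0) EU) := by
    rw [het, heU, Finset.smul_sum, Finset.smul_sum, ← Finset.sum_sub_distrib,
      ← Finset.sum_sub_distrib, ← Finset.sum_add_distrib]
    refine Finset.sum_congr rfl fun k _ => ?_
    rw [smul_smul, smul_smul, ← sub_smul, ← sub_smul, ← add_smul]
    congr 1
    rw [Finset.sum_mul, Finset.sum_mul, ← Finset.sum_sub_distrib, ← Finset.sum_sub_distrib]
    congr 1
    exact Finset.sum_congr rfl fun i _ => by ring
  have key : K = K +
      (∑ i ∈ I, ((w i : ℝ) : ℂ) * (((κ i : ℝ) : ℂ) * ((tp i - ∑ j ∈ I, w j * tp j : ℝ) : ℂ))) •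
        fermionEmbed (PolySite.incl h0) Et +
      (∑ i ∈ I, ((w i : ℝ) : ℂ) * (((κ i : ℝ) : ℂ) * ((U i - ∑ j ∈ I, w j * U j : ℝ) : ℂ))) •
        fermionEmbed (PolySite.incl h0) EU -
      (∑ i ∈ I, ((w i : ℝ) : ℂ) * (((κ i : ℝ) : ℂ) * ((tp i - ∑ j ∈ I, w j * tp j : ℝ) : ℂ))) •
        fermionEmbed (PolySite.incl h0) Et -
      (∑ i ∈ I, ((w i : ℝ) : ℂ) * (((κ i : ℝ) : ℂ) * ((U i - ∑ j ∈ I, w j * U j : ℝ) : ℂ))) •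
        fermionEmbed (PolySite.incl h0) EU := by abel
  rw [hsplit, key, hs]
  abel


/-! ### §3 The bound at the barycentre for torus-limit ground states -/

/-- **Box/cell certificate with per-corner multipliers (point-group-reduced form).** Corner window
certificates at `(t'ᵢ, Uᵢ)`, `i ∈ I`, as in `sum_smul_windowCertificates_TT'_eq` (free `κᵢ ≥ 0`,
free eom generators `Bᵢ`, `Λmᵢ ⪰ 0`), convex weights `wᵢ ≥ 0`, `Σ wᵢ = 1`, the θ-free dictionary
expansions `hqt, hqU, het, heU`, and ONE energy hypothesis `e(t, Σ w t', Σ w U, n) ≤ u'` at the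
barycentre: for every torus-limit ground state `ω` there,
`Σ wᵢcᵢ + (Σ wᵢκᵢuᵢ − (Σ wᵢκᵢ)u') − Σₘ ‖Σᵢ wᵢaᵢₘ + Rₘ‖ + (Σ_σ Σᵢ wᵢμᵢσ)(n/2 − ν)
  ≤ |S|⁻¹ Σ_{γ∈S} Re ω_{γΛ'}(Γ(d4Emb γ 0) X)`,
`Rₘ = Σᵢ wᵢ [ (t'ᵢ − t̄')(qtᵢₘ − κᵢ etₘ) + (Uᵢ − Ū)(qUᵢₘ − κᵢ eUₘ) ]`. [cite: WangEtAl2024, §III] -/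
theorem InfVolFermionState.IsTorusLimitOf.re_sum_expect_d4_ge_of_window_certificates_combination_TT'_ineq
    (t : ℝ) {ι₀ : Type*} (I : Finset ι₀) (w : ι₀ → ℝ) (hw0 : ∀ i ∈ I, 0 ≤ w i)
    (hw1 : ∑ i ∈ I, w i = 1) (tp U u c κ : ι₀ → ℝ) (hU : ∀ i ∈ I, 0 ≤ U i)
    (hκ : ∀ i ∈ I, 0 ≤ κ i) {n : ℝ} (hn0 : 0 ≤ n) (hn2 : n < 2) {u' : ℝ}
    (hu : ThermodynamicLimit.energyDensityTT' t (∑ i ∈ I, w i * tp i) (∑ i ∈ I, w i * U i) n ≤ u')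
    {Λ Λ' : Finset (Site 2)} (hΛ : Λ ⊆ Λ') (h8 : thicken Λ 1 ⊆ Λ')
    (h0 : thicken ({0} : Finset (Site 2)) 1 ⊆ Λ') (hz : (0 : Site 2) ∈ Λ')
    {S : Finset (DihedralGroup 4)} (h1 : (1 : DihedralGroup 4) ∈ S) (hmul : ∀ a ∈ S, ∀ b ∈ S, a * b ∈ S)
    (Xw : FermionOp Λ') (μ : ι₀ → Fin 2 → ℝ) (ν : ℝ)
    {m : Type*} [Fintype m] [DecidableEq m] (Λm : ι₀ → Matrix m m ℂ)
    (hΛm : ∀ i ∈ I, (Λm i).PosSemidef) (O : m → FermionOp Λ')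
    {κ' : Type*} (s : Finset κ') (B : ι₀ → κ' → FermionOp Λ)
    {ι : Type*} (tt : Finset ι) (γ : ι → DihedralGroup 4) (hγS : ∀ l ∈ tt, γ l ∈ S) (wv : ι → Site 2)
    (hsh : ∀ l, d4ShiftSet (γ l) (wv l) Λ ⊆ Λ') (Y : ι₀ → ι → FermionOp Λ)
    {ρ : Type*} (uu : Finset ρ) (b : ι₀ → ρ → ℂ) (cw : ρ → List (Orb (PolySite Λ') × Bool))
    (hcw : ∀ j ∈ uu, ladderCharge (cw j) ≠ 0 ∨ ladderSpinCharge (cw j) ≠ 0)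
    {δ : Type*} (ah : Finset δ) (dc : ι₀ → δ → ℝ) (V : δ → FermionOp Λ')
    {κ'' : Type*} (wd : Finset κ'') (a : ι₀ → κ'' → ℂ)
    (word : κ'' → List (Orb (PolySite Λ') × Bool))
    (qt qU : ι₀ → κ'' → ℂ) (et eU : κ'' → ℂ)
    (hqt : ∀ i ∈ I, ∑ k ∈ s, ((hubbardTTPrimeFermionInteraction 0 1 0).localHamiltonian Λ' *
          fermionEmbed (PolySite.incl hΛ) (B i k) -
        fermionEmbed (PolySite.incl hΛ) (B i k) *
          (hubbardTTPrimeFermionInteraction 0 1 0).localHamiltonian Λ') =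
      ∑ k ∈ wd, qt i k • ladderWord (word k))
    (hqU : ∀ i ∈ I, ∑ k ∈ s, ((hubbardTTPrimeFermionInteraction 0 0 1).localHamiltonian Λ' *
          fermionEmbed (PolySite.incl hΛ) (B i k) -
        fermionEmbed (PolySite.incl hΛ) (B i k) *
          (hubbardTTPrimeFermionInteraction 0 0 1).localHamiltonian Λ') =
      ∑ k ∈ wd, qU i k • ladderWord (word k))
    (het : fermionEmbed (PolySite.incl h0) ((hubbardTTPrimeFermionInteraction 0 1 0).meanEnergyObs 1) =
      ∑ k ∈ wd, et k • ladderWord (word k))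
    (heU : fermionEmbed (PolySite.incl h0) ((hubbardTTPrimeFermionInteraction 0 0 1).meanEnergyObs 1) =
      ∑ k ∈ wd, eU k • ladderWord (word k))
    (hcert : ∀ i ∈ I, Xw - ((c i : ℝ) : ℂ) • (1 : FermionOp Λ') -
        ∑ σ : Fin 2, ((μ i σ : ℝ) : ℂ) • (nAt 0 hz σ - ((ν : ℝ) : ℂ) • (1 : FermionOp Λ')) -
        ((κ i : ℝ) : ℂ) • (((u i : ℝ) : ℂ) • (1 : FermionOp Λ') -
          fermionEmbed (PolySite.incl h0)
            ((hubbardTTPrimeFermionInteraction t (tp i) (U i)).meanEnergyObs 1)) =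
      gramForm (Λm i) O +
        (∑ k ∈ s, ((hubbardTTPrimeFermionInteraction t (tp i) (U i)).localHamiltonian Λ' *
              fermionEmbed (PolySite.incl hΛ) (B i k) -
            fermionEmbed (PolySite.incl hΛ) (B i k) *
              (hubbardTTPrimeFermionInteraction t (tp i) (U i)).localHamiltonian Λ') +
          ∑ l ∈ tt, (fermionEmbed (PolySite.incl (hsh l))
              (fermionEmbed (PolySite.d4Emb (γ l) (wv l) Λ) (Y i l)) -
            fermionEmbed (PolySite.incl hΛ) (Y i l)) +
          ∑ j ∈ uu, b i j • ladderWord (cw j)) +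
        (∑ m' ∈ ah, ((dc i m' : ℝ) : ℂ) • ((V m')ᴴ - V m') + ∑ k ∈ wd, a i k • ladderWord (word k)))
    {Ls : ℕ → ℕ} (hLs : Tendsto Ls atTop atTop)
    {ψ : ∀ L, Fock (Orb (FermionTorus 2 L))}
    (hψ : ∀ j, IsGroundStateInSector
      (hubbardTorusTT' (Ls j) t (∑ i ∈ I, w i * tp i) (∑ i ∈ I, w i * U i))
      (ThermodynamicLimit.rectN n (Ls j)) 0 (ψ (Ls j)))
    (hψ1 : ∀ j, star (ψ (Ls j)) ⬝ᵥ ψ (Ls j) = 1)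
    {ω : InfVolFermionState 2} (hω : ω.IsTorusLimitOf ψ Ls) :
    ∑ i ∈ I, w i * c i + (∑ i ∈ I, w i * (κ i * u i) - (∑ i ∈ I, w i * κ i) * u') -
        ∑ k ∈ wd, ‖∑ i ∈ I, ((w i : ℝ) : ℂ) * a i k +
          ∑ i ∈ I, ((w i : ℝ) : ℂ) *
            ((((tp i - ∑ j ∈ I, w j * tp j : ℝ)) : ℂ) * (qt i k - ((κ i : ℝ) : ℂ) * et k) +
              (((U i - ∑ j ∈ I, w j * U j : ℝ)) : ℂ) * (qU i k - ((κ i : ℝ) : ℂ) * eU k))‖ +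
        (∑ σ : Fin 2, ∑ i ∈ I, w i * μ i σ) * (n / 2 - ν) ≤
      (S.card : ℝ)⁻¹ * ∑ g ∈ S,
        (ω.expect (d4ShiftSet g 0 Λ') (fermionEmbed (PolySite.d4Emb g 0 Λ') Xw)).re := by
  have hUbar : 0 ≤ ∑ i ∈ I, w i * U i :=
    Finset.sum_nonneg fun i hi => mul_nonneg (hw0 i hi) (hU i hi)
  have hκbar : 0 ≤ ∑ i ∈ I, w i * κ i :=
    Finset.sum_nonneg fun i hi => mul_nonneg (hw0 i hi) (hκ i hi)
  have hΛbar : (∑ i ∈ I, ((w i : ℝ) : ℂ) • Λm i).PosSemidef :=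
    Matrix.posSemidef_sum I fun i hi => (hΛm i hi).smul (Complex.zero_le_real.2 (hw0 i hi))
  have hs := sum_smul_windowCertificates_TT'_eq t I w hw1 tp U u c κ u' hΛ h0 hz Xw μ ν Λm O s B tt γ
    wv hsh Y uu b cw ah dc V wd a word qt qU et eU hqt hqU het heU hcert
  have h := hω.re_sum_expect_d4_ge_of_window_certificate_TT'_ineq t (∑ i ∈ I, w i * tp i) hUbar hn0
    hn2 hκbar hu hΛ h8 h0 hz h1 hmul Xw (fun σ => ∑ i ∈ I, w i * μ i σ) ν hΛbar O s
    (fun k => ∑ i ∈ I, ((w i : ℝ) : ℂ) • B i k) tt γ hγS wv hsh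
    (fun l => ∑ i ∈ I, ((w i : ℝ) : ℂ) • Y i l) uu (fun j => ∑ i ∈ I, ((w i : ℝ) : ℂ) * b i j) cw hcw
    ah (fun m' => ∑ i ∈ I, w i * dc i m') V wd
    (fun k => ∑ i ∈ I, ((w i : ℝ) : ℂ) * a i k +
      ∑ i ∈ I, ((w i : ℝ) : ℂ) *
        ((((tp i - ∑ j ∈ I, w j * tp j : ℝ)) : ℂ) * (qt i k - ((κ i : ℝ) : ℂ) * et k) +
          (((U i - ∑ j ∈ I, w j * U j : ℝ)) : ℂ) * (qU i k - ((κ i : ℝ) : ℂ) * eU k)))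
    word hs hLs hψ hψ1
  simpa using h

/-- **Translation-only form** (`γₗ = 1`): the bound is on `Re ω_{Λ'}(X)` itself. [cite: WangEtAl2024, §III] -/
theorem InfVolFermionState.IsTorusLimitOf.re_expect_ge_of_window_certificates_combination_TT'_ineq
    (t : ℝ) {ι₀ : Type*} (I : Finset ι₀) (w : ι₀ → ℝ) (hw0 : ∀ i ∈ I, 0 ≤ w i)
    (hw1 : ∑ i ∈ I, w i = 1) (tp U u c κ : ι₀ → ℝ) (hU : ∀ i ∈ I, 0 ≤ U i)
    (hκ : ∀ i ∈ I, 0 ≤ κ i) {n : ℝ} (hn0 : 0 ≤ n) (hn2 : n < 2) {u' : ℝ}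
    (hu : ThermodynamicLimit.energyDensityTT' t (∑ i ∈ I, w i * tp i) (∑ i ∈ I, w i * U i) n ≤ u')
    {Λ Λ' : Finset (Site 2)} (hΛ : Λ ⊆ Λ') (h8 : thicken Λ 1 ⊆ Λ')
    (h0 : thicken ({0} : Finset (Site 2)) 1 ⊆ Λ') (hz : (0 : Site 2) ∈ Λ')
    (Xw : FermionOp Λ') (μ : ι₀ → Fin 2 → ℝ) (ν : ℝ)
    {m : Type*} [Fintype m] [DecidableEq m] (Λm : ι₀ → Matrix m m ℂ)
    (hΛm : ∀ i ∈ I, (Λm i).PosSemidef) (O : m → FermionOp Λ')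
    {κ' : Type*} (s : Finset κ') (B : ι₀ → κ' → FermionOp Λ)
    {ι : Type*} (tt : Finset ι) (γ : ι → DihedralGroup 4) (hγ1 : ∀ l ∈ tt, γ l = 1) (wv : ι → Site 2)
    (hsh : ∀ l, d4ShiftSet (γ l) (wv l) Λ ⊆ Λ') (Y : ι₀ → ι → FermionOp Λ)
    {ρ : Type*} (uu : Finset ρ) (b : ι₀ → ρ → ℂ) (cw : ρ → List (Orb (PolySite Λ') × Bool))
    (hcw : ∀ j ∈ uu, ladderCharge (cw j) ≠ 0 ∨ ladderSpinCharge (cw j) ≠ 0)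
    {δ : Type*} (ah : Finset δ) (dc : ι₀ → δ → ℝ) (V : δ → FermionOp Λ')
    {κ'' : Type*} (wd : Finset κ'') (a : ι₀ → κ'' → ℂ)
    (word : κ'' → List (Orb (PolySite Λ') × Bool))
    (qt qU : ι₀ → κ'' → ℂ) (et eU : κ'' → ℂ)
    (hqt : ∀ i ∈ I, ∑ k ∈ s, ((hubbardTTPrimeFermionInteraction 0 1 0).localHamiltonian Λ' *
          fermionEmbed (PolySite.incl hΛ) (B i k) -
        fermionEmbed (PolySite.incl hΛ) (B i k) *
          (hubbardTTPrimeFermionInteraction 0 1 0).localHamiltonian Λ') =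
      ∑ k ∈ wd, qt i k • ladderWord (word k))
    (hqU : ∀ i ∈ I, ∑ k ∈ s, ((hubbardTTPrimeFermionInteraction 0 0 1).localHamiltonian Λ' *
          fermionEmbed (PolySite.incl hΛ) (B i k) -
        fermionEmbed (PolySite.incl hΛ) (B i k) *
          (hubbardTTPrimeFermionInteraction 0 0 1).localHamiltonian Λ') =
      ∑ k ∈ wd, qU i k • ladderWord (word k))
    (het : fermionEmbed (PolySite.incl h0) ((hubbardTTPrimeFermionInteraction 0 1 0).meanEnergyObs 1) =
      ∑ k ∈ wd, et k • ladderWord (word k))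
    (heU : fermionEmbed (PolySite.incl h0) ((hubbardTTPrimeFermionInteraction 0 0 1).meanEnergyObs 1) =
      ∑ k ∈ wd, eU k • ladderWord (word k))
    (hcert : ∀ i ∈ I, Xw - ((c i : ℝ) : ℂ) • (1 : FermionOp Λ') -
        ∑ σ : Fin 2, ((μ i σ : ℝ) : ℂ) • (nAt 0 hz σ - ((ν : ℝ) : ℂ) • (1 : FermionOp Λ')) -
        ((κ i : ℝ) : ℂ) • (((u i : ℝ) : ℂ) • (1 : FermionOp Λ') -
          fermionEmbed (PolySite.incl h0)
            ((hubbardTTPrimeFermionInteraction t (tp i) (U i)).meanEnergyObs 1)) =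
      gramForm (Λm i) O +
        (∑ k ∈ s, ((hubbardTTPrimeFermionInteraction t (tp i) (U i)).localHamiltonian Λ' *
              fermionEmbed (PolySite.incl hΛ) (B i k) -
            fermionEmbed (PolySite.incl hΛ) (B i k) *
              (hubbardTTPrimeFermionInteraction t (tp i) (U i)).localHamiltonian Λ') +
          ∑ l ∈ tt, (fermionEmbed (PolySite.incl (hsh l))
              (fermionEmbed (PolySite.d4Emb (γ l) (wv l) Λ) (Y i l)) -
            fermionEmbed (PolySite.incl hΛ) (Y i l)) +
          ∑ j ∈ uu, b i j • ladderWord (cw j)) +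
        (∑ m' ∈ ah, ((dc i m' : ℝ) : ℂ) • ((V m')ᴴ - V m') + ∑ k ∈ wd, a i k • ladderWord (word k)))
    {Ls : ℕ → ℕ} (hLs : Tendsto Ls atTop atTop)
    {ψ : ∀ L, Fock (Orb (FermionTorus 2 L))}
    (hψ : ∀ j, IsGroundStateInSector
      (hubbardTorusTT' (Ls j) t (∑ i ∈ I, w i * tp i) (∑ i ∈ I, w i * U i))
      (ThermodynamicLimit.rectN n (Ls j)) 0 (ψ (Ls j)))
    (hψ1 : ∀ j, star (ψ (Ls j)) ⬝ᵥ ψ (Ls j) = 1)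
    {ω : InfVolFermionState 2} (hω : ω.IsTorusLimitOf ψ Ls) :
    ∑ i ∈ I, w i * c i + (∑ i ∈ I, w i * (κ i * u i) - (∑ i ∈ I, w i * κ i) * u') -
        ∑ k ∈ wd, ‖∑ i ∈ I, ((w i : ℝ) : ℂ) * a i k +
          ∑ i ∈ I, ((w i : ℝ) : ℂ) *
            ((((tp i - ∑ j ∈ I, w j * tp j : ℝ)) : ℂ) * (qt i k - ((κ i : ℝ) : ℂ) * et k) +
              (((U i - ∑ j ∈ I, w j * U j : ℝ)) : ℂ) * (qU i k - ((κ i : ℝ) : ℂ) * eU k))‖ +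
        (∑ σ : Fin 2, ∑ i ∈ I, w i * μ i σ) * (n / 2 - ν) ≤ (ω.expect Λ' Xw).re := by
  have h1 : (1 : DihedralGroup 4) ∈ ({1} : Finset (DihedralGroup 4)) := Finset.mem_singleton_self 1
  have hmul : ∀ a ∈ ({1} : Finset (DihedralGroup 4)), ∀ b ∈ ({1} : Finset (DihedralGroup 4)),
      a * b ∈ ({1} : Finset (DihedralGroup 4)) := by
    intro a ha b hb
    rw [Finset.mem_singleton] at ha hb ⊢
    rw [ha, hb, mul_one]
  have hγS : ∀ l ∈ tt, γ l ∈ ({1} : Finset (DihedralGroup 4)) := fun l hl =>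
    Finset.mem_singleton.2 (hγ1 l hl)
  have h := hω.re_sum_expect_d4_ge_of_window_certificates_combination_TT'_ineq t I w hw0 hw1 tp U u c κ
    hU hκ hn0 hn2 hu hΛ h8 h0 hz h1 hmul Xw μ ν Λm hΛm O s B tt γ hγS wv hsh Y uu b cw hcw ah dc V
    wd a word qt qU et eU hqt hqU het heU hcert hLs hψ hψ1
  rwa [Finset.sum_singleton, Finset.card_singleton, Nat.cast_one, inv_one, one_mul,
    ω.expect_fermionEmbed_d4Emb_one_zero] at h

/-- **Weighted-corner form with remainder** (what the cell evaluator uses): the weighted mean of the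
CORNER bounds, corrected by the multiplier–cap covariance `Σ wᵢκᵢuᵢ − κ̄u'` and by the computable
remainder charge `Σₘ ‖Rₘ‖`, bounds `Re ω_{Λ'}(X)` at the barycentre (`‖ā + R‖ ≤ Σ wᵢ‖aᵢ‖ + ‖R‖`).
[cite: WangEtAl2024, §III] -/
theorem InfVolFermionState.IsTorusLimitOf.re_expect_ge_of_window_certificates_combination_TT'_ineq_weighted
    (t : ℝ) {ι₀ : Type*} (I : Finset ι₀) (w : ι₀ → ℝ) (hw0 : ∀ i ∈ I, 0 ≤ w i)
    (hw1 : ∑ i ∈ I, w i = 1) (tp U u c κ : ι₀ → ℝ) (hU : ∀ i ∈ I, 0 ≤ U i)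
    (hκ : ∀ i ∈ I, 0 ≤ κ i) {n : ℝ} (hn0 : 0 ≤ n) (hn2 : n < 2) {u' : ℝ}
    (hu : ThermodynamicLimit.energyDensityTT' t (∑ i ∈ I, w i * tp i) (∑ i ∈ I, w i * U i) n ≤ u')
    {Λ Λ' : Finset (Site 2)} (hΛ : Λ ⊆ Λ') (h8 : thicken Λ 1 ⊆ Λ')
    (h0 : thicken ({0} : Finset (Site 2)) 1 ⊆ Λ') (hz : (0 : Site 2) ∈ Λ')
    (Xw : FermionOp Λ') (μ : ι₀ → Fin 2 → ℝ) (ν : ℝ)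
    {m : Type*} [Fintype m] [DecidableEq m] (Λm : ι₀ → Matrix m m ℂ)
    (hΛm : ∀ i ∈ I, (Λm i).PosSemidef) (O : m → FermionOp Λ')
    {κ' : Type*} (s : Finset κ') (B : ι₀ → κ' → FermionOp Λ)
    {ι : Type*} (tt : Finset ι) (γ : ι → DihedralGroup 4) (hγ1 : ∀ l ∈ tt, γ l = 1) (wv : ι → Site 2)
    (hsh : ∀ l, d4ShiftSet (γ l) (wv l) Λ ⊆ Λ') (Y : ι₀ → ι → FermionOp Λ)
    {ρ : Type*} (uu : Finset ρ) (b : ι₀ → ρ → ℂ) (cw : ρ → List (Orb (PolySite Λ') × Bool))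
    (hcw : ∀ j ∈ uu, ladderCharge (cw j) ≠ 0 ∨ ladderSpinCharge (cw j) ≠ 0)
    {δ : Type*} (ah : Finset δ) (dc : ι₀ → δ → ℝ) (V : δ → FermionOp Λ')
    {κ'' : Type*} (wd : Finset κ'') (a : ι₀ → κ'' → ℂ)
    (word : κ'' → List (Orb (PolySite Λ') × Bool))
    (qt qU : ι₀ → κ'' → ℂ) (et eU : κ'' → ℂ)
    (hqt : ∀ i ∈ I, ∑ k ∈ s, ((hubbardTTPrimeFermionInteraction 0 1 0).localHamiltonian Λ' *
          fermionEmbed (PolySite.incl hΛ) (B i k) -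
        fermionEmbed (PolySite.incl hΛ) (B i k) *
          (hubbardTTPrimeFermionInteraction 0 1 0).localHamiltonian Λ') =
      ∑ k ∈ wd, qt i k • ladderWord (word k))
    (hqU : ∀ i ∈ I, ∑ k ∈ s, ((hubbardTTPrimeFermionInteraction 0 0 1).localHamiltonian Λ' *
          fermionEmbed (PolySite.incl hΛ) (B i k) -
        fermionEmbed (PolySite.incl hΛ) (B i k) *
          (hubbardTTPrimeFermionInteraction 0 0 1).localHamiltonian Λ') =
      ∑ k ∈ wd, qU i k • ladderWord (word k))
    (het : fermionEmbed (PolySite.incl h0) ((hubbardTTPrimeFermionInteraction 0 1 0).meanEnergyObs 1) =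
      ∑ k ∈ wd, et k • ladderWord (word k))
    (heU : fermionEmbed (PolySite.incl h0) ((hubbardTTPrimeFermionInteraction 0 0 1).meanEnergyObs 1) =
      ∑ k ∈ wd, eU k • ladderWord (word k))
    (hcert : ∀ i ∈ I, Xw - ((c i : ℝ) : ℂ) • (1 : FermionOp Λ') -
        ∑ σ : Fin 2, ((μ i σ : ℝ) : ℂ) • (nAt 0 hz σ - ((ν : ℝ) : ℂ) • (1 : FermionOp Λ')) -
        ((κ i : ℝ) : ℂ) • (((u i : ℝ) : ℂ) • (1 : FermionOp Λ') -
          fermionEmbed (PolySite.incl h0)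
            ((hubbardTTPrimeFermionInteraction t (tp i) (U i)).meanEnergyObs 1)) =
      gramForm (Λm i) O +
        (∑ k ∈ s, ((hubbardTTPrimeFermionInteraction t (tp i) (U i)).localHamiltonian Λ' *
              fermionEmbed (PolySite.incl hΛ) (B i k) -
            fermionEmbed (PolySite.incl hΛ) (B i k) *
              (hubbardTTPrimeFermionInteraction t (tp i) (U i)).localHamiltonian Λ') +
          ∑ l ∈ tt, (fermionEmbed (PolySite.incl (hsh l))
              (fermionEmbed (PolySite.d4Emb (γ l) (wv l) Λ) (Y i l)) -
            fermionEmbed (PolySite.incl hΛ) (Y i l)) +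
          ∑ j ∈ uu, b i j • ladderWord (cw j)) +
        (∑ m' ∈ ah, ((dc i m' : ℝ) : ℂ) • ((V m')ᴴ - V m') + ∑ k ∈ wd, a i k • ladderWord (word k)))
    {Ls : ℕ → ℕ} (hLs : Tendsto Ls atTop atTop)
    {ψ : ∀ L, Fock (Orb (FermionTorus 2 L))}
    (hψ : ∀ j, IsGroundStateInSector
      (hubbardTorusTT' (Ls j) t (∑ i ∈ I, w i * tp i) (∑ i ∈ I, w i * U i))
      (ThermodynamicLimit.rectN n (Ls j)) 0 (ψ (Ls j)))
    (hψ1 : ∀ j, star (ψ (Ls j)) ⬝ᵥ ψ (Ls j) = 1)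
    {ω : InfVolFermionState 2} (hω : ω.IsTorusLimitOf ψ Ls) :
    ∑ i ∈ I, w i * (c i - ∑ k ∈ wd, ‖a i k‖ + (∑ σ : Fin 2, μ i σ) * (n / 2 - ν)) +
        (∑ i ∈ I, w i * (κ i * u i) - (∑ i ∈ I, w i * κ i) * u') -
        ∑ k ∈ wd, ‖∑ i ∈ I, ((w i : ℝ) : ℂ) *
            ((((tp i - ∑ j ∈ I, w j * tp j : ℝ)) : ℂ) * (qt i k - ((κ i : ℝ) : ℂ) * et k) +
              (((U i - ∑ j ∈ I, w j * U j : ℝ)) : ℂ) * (qU i k - ((κ i : ℝ) : ℂ) * eU k))‖ ≤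
      (ω.expect Λ' Xw).re := by
  have h := hω.re_expect_ge_of_window_certificates_combination_TT'_ineq t I w hw0 hw1 tp U u c κ hU hκ
    hn0 hn2 hu hΛ h8 h0 hz Xw μ ν Λm hΛm O s B tt γ hγ1 wv hsh Y uu b cw hcw ah dc V wd a word qt qU
    et eU hqt hqU het heU hcert hLs hψ hψ1
  -- `‖Σ w a + R‖ ≤ Σ w ‖a‖ + ‖R‖`
  have htri : ∑ k ∈ wd, ‖∑ i ∈ I, ((w i : ℝ) : ℂ) * a i k +
          ∑ i ∈ I, ((w i : ℝ) : ℂ) *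
            ((((tp i - ∑ j ∈ I, w j * tp j : ℝ)) : ℂ) * (qt i k - ((κ i : ℝ) : ℂ) * et k) +
              (((U i - ∑ j ∈ I, w j * U j : ℝ)) : ℂ) * (qU i k - ((κ i : ℝ) : ℂ) * eU k))‖ ≤
      ∑ k ∈ wd, ∑ i ∈ I, w i * ‖a i k‖ +
        ∑ k ∈ wd, ‖∑ i ∈ I, ((w i : ℝ) : ℂ) *
            ((((tp i - ∑ j ∈ I, w j * tp j : ℝ)) : ℂ) * (qt i k - ((κ i : ℝ) : ℂ) * et k) +
              (((U i - ∑ j ∈ I, w j * U j : ℝ)) : ℂ) * (qU i k - ((κ i : ℝ) : ℂ) * eU k))‖ := by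
    rw [← Finset.sum_add_distrib]
    refine Finset.sum_le_sum fun k _ => (norm_add_le _ _).trans (add_le_add ?_ le_rfl)
    refine (norm_sum_le _ _).trans (Finset.sum_le_sum fun i hi => ?_)
    rw [norm_mul, Complex.norm_real, Real.norm_of_nonneg (hw0 i hi)]
  -- rearrange the weighted corner bounds
  have hre : ∑ i ∈ I, w i * (c i - ∑ k ∈ wd, ‖a i k‖ + (∑ σ : Fin 2, μ i σ) * (n / 2 - ν)) =
      ∑ i ∈ I, w i * c i - ∑ k ∈ wd, ∑ i ∈ I, w i * ‖a i k‖ +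
        (∑ σ : Fin 2, ∑ i ∈ I, w i * μ i σ) * (n / 2 - ν) := by
    have e1 : ∀ i, w i * (c i - ∑ k ∈ wd, ‖a i k‖ + (∑ σ : Fin 2, μ i σ) * (n / 2 - ν)) =
        w i * c i - ∑ k ∈ wd, w i * ‖a i k‖ + ∑ σ : Fin 2, w i * μ i σ * (n / 2 - ν) := by
      intro i
      rw [mul_add, mul_sub, Finset.mul_sum, Finset.sum_mul, Finset.mul_sum]
      simp_rw [mul_assoc]
    simp_rw [e1]
    rw [Finset.sum_add_distrib, Finset.sum_sub_distrib, Finset.sum_comm (s := I) (t := wd)]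
    congr 1
    rw [Finset.sum_mul, Finset.sum_comm]
    exact Finset.sum_congr rfl fun σ _ => by rw [Finset.sum_mul]
  rw [hre]
  linarith


/-! ### §4 The CELL FLOOR: a bound uniform over the hull from corner data, reference charges and ranges -/

/-- **Weighted mean absolute deviation ≤ half the range**: for convex weights and `xᵢ ∈ [α, β]`,
`Σ wᵢ |xᵢ − x̄| ≤ (β − α)/2`, `x̄ = Σ wᵢ xᵢ` (tight for two corners at the midpoint). [folklore]
[cite: HardyLittlewoodPolya1952, elementary (mean deviation about the mean is at most half the range); proved here] -/
theorem sum_mul_abs_sub_wmean_le_half_width {ι : Type*} (I : Finset ι) (w x : ι → ℝ)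
    (hw0 : ∀ i ∈ I, 0 ≤ w i) (hw1 : ∑ i ∈ I, w i = 1) {α β : ℝ}
    (hx : ∀ i ∈ I, α ≤ x i ∧ x i ≤ β) :
    ∑ i ∈ I, w i * |x i - ∑ j ∈ I, w j * x j| ≤ (β - α) / 2 := by
  have hxb_ge : α ≤ ∑ j ∈ I, w j * x j :=
    calc α = ∑ j ∈ I, w j * α := by rw [← Finset.sum_mul, hw1, one_mul]
      _ ≤ ∑ j ∈ I, w j * x j :=
        Finset.sum_le_sum fun j hj => mul_le_mul_of_nonneg_left (hx j hj).1 (hw0 j hj)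
  have hxb_le : ∑ j ∈ I, w j * x j ≤ β :=
    calc ∑ j ∈ I, w j * x j ≤ ∑ j ∈ I, w j * β :=
        Finset.sum_le_sum fun j hj => mul_le_mul_of_nonneg_left (hx j hj).2 (hw0 j hj)
      _ = β := by rw [← Finset.sum_mul, hw1, one_mul]
  -- pointwise: `(β−α)|x−x̄| ≤ (x̄−α)(β−x) + (β−x̄)(x−α)` on `[α, β]`
  have hpt : ∀ i ∈ I, (β - α) * (w i * |x i - ∑ j ∈ I, w j * x j|) ≤
      w i * (((∑ j ∈ I, w j * x j) - α) * (β - x i) + (β - ∑ j ∈ I, w j * x j) * (x i - α)) := by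
    intro i hi
    rw [← mul_assoc, mul_comm (β - α) (w i), mul_assoc]
    refine mul_le_mul_of_nonneg_left ?_ (hw0 i hi)
    obtain ⟨h1, h2⟩ := hx i hi
    rcases le_total (x i) (∑ j ∈ I, w j * x j) with h | h
    · rw [abs_of_nonpos (sub_nonpos.2 h)]; nlinarith
    · rw [abs_of_nonneg (sub_nonneg.2 h)]; nlinarith
  have hsum : (β - α) * ∑ i ∈ I, w i * |x i - ∑ j ∈ I, w j * x j| ≤
      2 * (((∑ j ∈ I, w j * x j) - α) * (β - ∑ j ∈ I, w j * x j)) := by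
    rw [Finset.mul_sum]
    refine (Finset.sum_le_sum hpt).trans (le_of_eq ?_)
    have e : ∀ i, w i * (((∑ j ∈ I, w j * x j) - α) * (β - x i) +
        (β - ∑ j ∈ I, w j * x j) * (x i - α)) =
        ((∑ j ∈ I, w j * x j) - α) * β * w i - ((∑ j ∈ I, w j * x j) - α) * (w i * x i) +
          (β - ∑ j ∈ I, w j * x j) * (w i * x i) - (β - ∑ j ∈ I, w j * x j) * α * w i := by
      intro i; ring
    simp_rw [e]
    rw [Finset.sum_sub_distrib, Finset.sum_add_distrib, Finset.sum_sub_distrib, ← Finset.mul_sum,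
      ← Finset.mul_sum, ← Finset.mul_sum, ← Finset.mul_sum, hw1]
    ring
  rcases (hxb_ge.trans hxb_le).eq_or_lt with h | h
  · -- degenerate interval: every deviation vanishes
    have h0 : ∑ i ∈ I, w i * |x i - ∑ j ∈ I, w j * x j| = 0 := by
      refine Finset.sum_eq_zero fun i hi => ?_
      have hxi : x i = ∑ j ∈ I, w j * x j := by
        have h1 := (hx i hi).1; have h2 := (hx i hi).2; linarith
      rw [hxi, sub_self, abs_zero, mul_zero]
    rw [h0]
    linarith
  · have hab : 0 < β - α := sub_pos.2 h
    have h2 : 2 * (((∑ j ∈ I, w j * x j) - α) * (β - ∑ j ∈ I, w j * x j)) ≤ (β - α) * ((β - α) / 2) := by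
      nlinarith [sq_nonneg ((∑ j ∈ I, w j * x j) - α - (β - ∑ j ∈ I, w j * x j))]
    exact le_of_mul_le_mul_left (hsum.trans h2) hab

/-- **Cell floor for the correlator (translation-only form).** Corner certificates as in
`…re_expect_ge_of_window_certificates_combination_TT'_ineq_weighted`; an AFFINE energy majorant
with corner values `Mᵢ` valid at the barycentre (`e ≤ Σ wᵢ Mᵢ`, e.g. a tangent upper bound);
a floor `F ≤ cᵢ − Σₘ‖aᵢₘ‖ + (Σ_σ μᵢσ)(n/2 − ν) − κᵢ (Mᵢ − uᵢ)` of the cap-adjusted corner bounds;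
a multiplier radius `|κᵢ − k| ≤ rκ`; ranges `Mᵢ ∈ [αM, βM]`, `t'ᵢ ∈ [αt, βt]`, `Uᵢ ∈ [αU, βU]`; and
reference coupling charges `Ctₘ, CUₘ` with radii `‖qtᵢₘ − κᵢetₘ − Ctₘ‖ ≤ rtₘ`,
`‖qUᵢₘ − κᵢeUₘ − CUₘ‖ ≤ rUₘ`. Then, WHATEVER the convex weights,
`F − rκ (βM − αM)/2 − ((βt − αt)/2 · Σₘ rtₘ + (βU − αU)/2 · Σₘ rUₘ) ≤ Re ω_{Λ'}(X)`
for every torus-limit ground state at the barycentre: one number certifies the whole hull of the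
corners (for two corners: `|Δκ||ΔM|/4 + |Δt'|/4 Σₘ‖Δ(qt − κet)ₘ‖ + |ΔU|/4 Σₘ‖Δ(qU − κeU)ₘ‖` below
the smaller cap-adjusted corner bound). [cite: WangEtAl2024, §III] -/
theorem InfVolFermionState.IsTorusLimitOf.re_expect_ge_cellFloor_of_window_certificates_TT'_ineq
    (t : ℝ) {ι₀ : Type*} (I : Finset ι₀) (w : ι₀ → ℝ) (hw0 : ∀ i ∈ I, 0 ≤ w i)
    (hw1 : ∑ i ∈ I, w i = 1) (tp U u c κ M : ι₀ → ℝ) (hU : ∀ i ∈ I, 0 ≤ U i)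
    (hκ : ∀ i ∈ I, 0 ≤ κ i) {n : ℝ} (hn0 : 0 ≤ n) (hn2 : n < 2)
    (hu : ThermodynamicLimit.energyDensityTT' t (∑ i ∈ I, w i * tp i) (∑ i ∈ I, w i * U i) n ≤
      ∑ i ∈ I, w i * M i)
    {Λ Λ' : Finset (Site 2)} (hΛ : Λ ⊆ Λ') (h8 : thicken Λ 1 ⊆ Λ')
    (h0 : thicken ({0} : Finset (Site 2)) 1 ⊆ Λ') (hz : (0 : Site 2) ∈ Λ')
    (Xw : FermionOp Λ') (μ : ι₀ → Fin 2 → ℝ) (ν : ℝ)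
    {m : Type*} [Fintype m] [DecidableEq m] (Λm : ι₀ → Matrix m m ℂ)
    (hΛm : ∀ i ∈ I, (Λm i).PosSemidef) (O : m → FermionOp Λ')
    {κ' : Type*} (s : Finset κ') (B : ι₀ → κ' → FermionOp Λ)
    {ι : Type*} (tt : Finset ι) (γ : ι → DihedralGroup 4) (hγ1 : ∀ l ∈ tt, γ l = 1) (wv : ι → Site 2)
    (hsh : ∀ l, d4ShiftSet (γ l) (wv l) Λ ⊆ Λ') (Y : ι₀ → ι → FermionOp Λ)
    {ρ : Type*} (uu : Finset ρ) (b : ι₀ → ρ → ℂ) (cw : ρ → List (Orb (PolySite Λ') × Bool))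
    (hcw : ∀ j ∈ uu, ladderCharge (cw j) ≠ 0 ∨ ladderSpinCharge (cw j) ≠ 0)
    {δ : Type*} (ah : Finset δ) (dc : ι₀ → δ → ℝ) (V : δ → FermionOp Λ')
    {κ'' : Type*} (wd : Finset κ'') (a : ι₀ → κ'' → ℂ)
    (word : κ'' → List (Orb (PolySite Λ') × Bool))
    (qt qU : ι₀ → κ'' → ℂ) (et eU : κ'' → ℂ)
    (hqt : ∀ i ∈ I, ∑ k ∈ s, ((hubbardTTPrimeFermionInteraction 0 1 0).localHamiltonian Λ' *
          fermionEmbed (PolySite.incl hΛ) (B i k) -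
        fermionEmbed (PolySite.incl hΛ) (B i k) *
          (hubbardTTPrimeFermionInteraction 0 1 0).localHamiltonian Λ') =
      ∑ k ∈ wd, qt i k • ladderWord (word k))
    (hqU : ∀ i ∈ I, ∑ k ∈ s, ((hubbardTTPrimeFermionInteraction 0 0 1).localHamiltonian Λ' *
          fermionEmbed (PolySite.incl hΛ) (B i k) -
        fermionEmbed (PolySite.incl hΛ) (B i k) *
          (hubbardTTPrimeFermionInteraction 0 0 1).localHamiltonian Λ') =
      ∑ k ∈ wd, qU i k • ladderWord (word k))
    (het : fermionEmbed (PolySite.incl h0) ((hubbardTTPrimeFermionInteraction 0 1 0).meanEnergyObs 1) =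
      ∑ k ∈ wd, et k • ladderWord (word k))
    (heU : fermionEmbed (PolySite.incl h0) ((hubbardTTPrimeFermionInteraction 0 0 1).meanEnergyObs 1) =
      ∑ k ∈ wd, eU k • ladderWord (word k))
    (hcert : ∀ i ∈ I, Xw - ((c i : ℝ) : ℂ) • (1 : FermionOp Λ') -
        ∑ σ : Fin 2, ((μ i σ : ℝ) : ℂ) • (nAt 0 hz σ - ((ν : ℝ) : ℂ) • (1 : FermionOp Λ')) -
        ((κ i : ℝ) : ℂ) • (((u i : ℝ) : ℂ) • (1 : FermionOp Λ') -
          fermionEmbed (PolySite.incl h0)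
            ((hubbardTTPrimeFermionInteraction t (tp i) (U i)).meanEnergyObs 1)) =
      gramForm (Λm i) O +
        (∑ k ∈ s, ((hubbardTTPrimeFermionInteraction t (tp i) (U i)).localHamiltonian Λ' *
              fermionEmbed (PolySite.incl hΛ) (B i k) -
            fermionEmbed (PolySite.incl hΛ) (B i k) *
              (hubbardTTPrimeFermionInteraction t (tp i) (U i)).localHamiltonian Λ') +
          ∑ l ∈ tt, (fermionEmbed (PolySite.incl (hsh l))
              (fermionEmbed (PolySite.d4Emb (γ l) (wv l) Λ) (Y i l)) -
            fermionEmbed (PolySite.incl hΛ) (Y i l)) +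
          ∑ j ∈ uu, b i j • ladderWord (cw j)) +
        (∑ m' ∈ ah, ((dc i m' : ℝ) : ℂ) • ((V m')ᴴ - V m') + ∑ k ∈ wd, a i k • ladderWord (word k)))
    {F : ℝ} (hF : ∀ i ∈ I, F ≤ c i - ∑ k ∈ wd, ‖a i k‖ + (∑ σ : Fin 2, μ i σ) * (n / 2 - ν) -
      κ i * (M i - u i))
    {kref rκ : ℝ} (hkr : ∀ i ∈ I, |κ i - kref| ≤ rκ)
    {αM βM : ℝ} (hMr : ∀ i ∈ I, αM ≤ M i ∧ M i ≤ βM)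
    {αt βt : ℝ} (htr : ∀ i ∈ I, αt ≤ tp i ∧ tp i ≤ βt)
    {αU βU : ℝ} (hUr : ∀ i ∈ I, αU ≤ U i ∧ U i ≤ βU)
    (Ct CU : κ'' → ℂ) (rt rU : κ'' → ℝ)
    (hrt : ∀ i ∈ I, ∀ k ∈ wd, ‖qt i k - ((κ i : ℝ) : ℂ) * et k - Ct k‖ ≤ rt k)
    (hrU : ∀ i ∈ I, ∀ k ∈ wd, ‖qU i k - ((κ i : ℝ) : ℂ) * eU k - CU k‖ ≤ rU k)
    {Ls : ℕ → ℕ} (hLs : Tendsto Ls atTop atTop)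
    {ψ : ∀ L, Fock (Orb (FermionTorus 2 L))}
    (hψ : ∀ j, IsGroundStateInSector
      (hubbardTorusTT' (Ls j) t (∑ i ∈ I, w i * tp i) (∑ i ∈ I, w i * U i))
      (ThermodynamicLimit.rectN n (Ls j)) 0 (ψ (Ls j)))
    (hψ1 : ∀ j, star (ψ (Ls j)) ⬝ᵥ ψ (Ls j) = 1)
    {ω : InfVolFermionState 2} (hω : ω.IsTorusLimitOf ψ Ls) :
    F - rκ * ((βM - αM) / 2) - ((βt - αt) / 2 * ∑ k ∈ wd, rt k + (βU - αU) / 2 * ∑ k ∈ wd, rU k) ≤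
      (ω.expect Λ' Xw).re := by
  have h := hω.re_expect_ge_of_window_certificates_combination_TT'_ineq_weighted t I w hw0 hw1 tp U u c
    κ hU hκ hn0 hn2 hu hΛ h8 h0 hz Xw μ ν Λm hΛm O s B tt γ hγ1 wv hsh Y uu b cw hcw ah dc V wd a word
    qt qU et eU hqt hqU het heU hcert hLs hψ hψ1
  obtain ⟨i₀, hi₀, -⟩ := Finset.exists_ne_zero_of_sum_ne_zero (by rw [hw1]; exact one_ne_zero :
    ∑ i ∈ I, w i ≠ 0)
  -- (1) the corner part: floor, cap adjustment and the multiplier–majorant covariance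
  have G : F ≤ ∑ i ∈ I, w i * (c i - ∑ k ∈ wd, ‖a i k‖ + (∑ σ : Fin 2, μ i σ) * (n / 2 - ν) -
      κ i * (M i - u i)) :=
    calc F = ∑ i ∈ I, w i * F := by rw [← Finset.sum_mul, hw1, one_mul]
      _ ≤ _ := Finset.sum_le_sum fun i hi => mul_le_mul_of_nonneg_left (hF i hi) (hw0 i hi)
  have D : ∑ i ∈ I, w i * (c i - ∑ k ∈ wd, ‖a i k‖ + (∑ σ : Fin 2, μ i σ) * (n / 2 - ν)) -
      ∑ i ∈ I, w i * (κ i * M i) + ∑ i ∈ I, w i * (κ i * u i) =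
      ∑ i ∈ I, w i * (c i - ∑ k ∈ wd, ‖a i k‖ + (∑ σ : Fin 2, μ i σ) * (n / 2 - ν) -
        κ i * (M i - u i)) := by
    rw [← Finset.sum_sub_distrib, ← Finset.sum_add_distrib]
    exact Finset.sum_congr rfl fun i _ => by ring
  have E2 : ∑ i ∈ I, w i * ((κ i - kref) * (M i - ∑ j ∈ I, w j * M j)) =
      ∑ i ∈ I, w i * (κ i * M i) - (∑ i ∈ I, w i * κ i) * (∑ i ∈ I, w i * M i) := by
    have e : ∀ i, w i * ((κ i - kref) * (M i - ∑ j ∈ I, w j * M j)) =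
        w i * (κ i * M i) - (w i * κ i) * (∑ j ∈ I, w j * M j) - kref * (w i * M i) +
          kref * (∑ j ∈ I, w j * M j) * w i := fun i => by ring
    simp_rw [e]
    rw [Finset.sum_add_distrib, Finset.sum_sub_distrib, Finset.sum_sub_distrib, ← Finset.sum_mul,
      ← Finset.mul_sum, ← Finset.mul_sum, hw1]
    ring
  have E3 : -(rκ * ((βM - αM) / 2)) ≤ ∑ i ∈ I, w i * ((κ i - kref) * (M i - ∑ j ∈ I, w j * M j)) := by
    have hmad := sum_mul_abs_sub_wmean_le_half_width I w M hw0 hw1 hMr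
    have hrκ0 : 0 ≤ rκ := (abs_nonneg _).trans (hkr i₀ hi₀)
    have hpt : ∀ i ∈ I, -(w i * (rκ * |M i - ∑ j ∈ I, w j * M j|)) ≤
        w i * ((κ i - kref) * (M i - ∑ j ∈ I, w j * M j)) := by
      intro i hi
      have h1 : |(κ i - kref) * (M i - ∑ j ∈ I, w j * M j)| ≤ rκ * |M i - ∑ j ∈ I, w j * M j| := by
        rw [abs_mul]; exact mul_le_mul_of_nonneg_right (hkr i hi) (abs_nonneg _)
      have h2 := neg_abs_le ((κ i - kref) * (M i - ∑ j ∈ I, w j * M j))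
      have h3 := mul_le_mul_of_nonneg_left h2 (hw0 i hi)
      have h4 := mul_le_mul_of_nonneg_left h1 (hw0 i hi)
      rw [mul_neg] at h3
      linarith
    calc -(rκ * ((βM - αM) / 2)) ≤ -(rκ * ∑ i ∈ I, w i * |M i - ∑ j ∈ I, w j * M j|) :=
        neg_le_neg (mul_le_mul_of_nonneg_left hmad hrκ0)
      _ = ∑ i ∈ I, -(w i * (rκ * |M i - ∑ j ∈ I, w j * M j|)) := by
        rw [Finset.mul_sum, ← Finset.sum_neg_distrib]
        exact Finset.sum_congr rfl fun i _ => by ring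
      _ ≤ _ := Finset.sum_le_sum hpt
  -- (2) the remainder part: recentre at the reference charges, then MAD of the couplings
  have hdt : ∑ i ∈ I, ((w i : ℝ) : ℂ) * ((tp i - ∑ j ∈ I, w j * tp j : ℝ) : ℂ) = 0 := by
    have e : ∑ i ∈ I, w i * (tp i - ∑ j ∈ I, w j * tp j) = 0 := by
      simp_rw [mul_sub]
      rw [Finset.sum_sub_distrib, ← Finset.sum_mul, hw1, one_mul, sub_self]
    exact_mod_cast e
  have hdU : ∑ i ∈ I, ((w i : ℝ) : ℂ) * ((U i - ∑ j ∈ I, w j * U j : ℝ) : ℂ) = 0 := by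
    have e : ∑ i ∈ I, w i * (U i - ∑ j ∈ I, w j * U j) = 0 := by
      simp_rw [mul_sub]
      rw [Finset.sum_sub_distrib, ← Finset.sum_mul, hw1, one_mul, sub_self]
    exact_mod_cast e
  have hRk : ∀ k, ∑ i ∈ I, ((w i : ℝ) : ℂ) *
        ((((tp i - ∑ j ∈ I, w j * tp j : ℝ)) : ℂ) * (qt i k - ((κ i : ℝ) : ℂ) * et k) +
          (((U i - ∑ j ∈ I, w j * U j : ℝ)) : ℂ) * (qU i k - ((κ i : ℝ) : ℂ) * eU k)) =
      ∑ i ∈ I, ((w i : ℝ) : ℂ) *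
        ((((tp i - ∑ j ∈ I, w j * tp j : ℝ)) : ℂ) * (qt i k - ((κ i : ℝ) : ℂ) * et k - Ct k) +
          (((U i - ∑ j ∈ I, w j * U j : ℝ)) : ℂ) * (qU i k - ((κ i : ℝ) : ℂ) * eU k - CU k)) := by
    intro k
    have e : ∑ i ∈ I, ((w i : ℝ) : ℂ) *
        ((((tp i - ∑ j ∈ I, w j * tp j : ℝ)) : ℂ) * (qt i k - ((κ i : ℝ) : ℂ) * et k - Ct k) +
          (((U i - ∑ j ∈ I, w j * U j : ℝ)) : ℂ) * (qU i k - ((κ i : ℝ) : ℂ) * eU k - CU k)) =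
        ∑ i ∈ I, ((w i : ℝ) : ℂ) *
          ((((tp i - ∑ j ∈ I, w j * tp j : ℝ)) : ℂ) * (qt i k - ((κ i : ℝ) : ℂ) * et k) +
            (((U i - ∑ j ∈ I, w j * U j : ℝ)) : ℂ) * (qU i k - ((κ i : ℝ) : ℂ) * eU k)) -
          (∑ i ∈ I, ((w i : ℝ) : ℂ) * ((tp i - ∑ j ∈ I, w j * tp j : ℝ) : ℂ)) * Ct k -
          (∑ i ∈ I, ((w i : ℝ) : ℂ) * ((U i - ∑ j ∈ I, w j * U j : ℝ) : ℂ)) * CU k := by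
      rw [Finset.sum_mul, Finset.sum_mul, ← Finset.sum_sub_distrib, ← Finset.sum_sub_distrib]
      exact Finset.sum_congr rfl fun i _ => by ring
    rw [e, hdt, hdU, zero_mul, zero_mul, sub_zero, sub_zero]
  have hmadt := sum_mul_abs_sub_wmean_le_half_width I w tp hw0 hw1 htr
  have hmadU := sum_mul_abs_sub_wmean_le_half_width I w U hw0 hw1 hUr
  have hRn : ∀ k ∈ wd, ‖∑ i ∈ I, ((w i : ℝ) : ℂ) *
        ((((tp i - ∑ j ∈ I, w j * tp j : ℝ)) : ℂ) * (qt i k - ((κ i : ℝ) : ℂ) * et k) +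
          (((U i - ∑ j ∈ I, w j * U j : ℝ)) : ℂ) * (qU i k - ((κ i : ℝ) : ℂ) * eU k))‖ ≤
      (βt - αt) / 2 * rt k + (βU - αU) / 2 * rU k := by
    intro k hk
    rw [hRk k]
    have hrt0 : 0 ≤ rt k := (norm_nonneg _).trans (hrt i₀ hi₀ k hk)
    have hrU0 : 0 ≤ rU k := (norm_nonneg _).trans (hrU i₀ hi₀ k hk)
    calc ‖∑ i ∈ I, ((w i : ℝ) : ℂ) *
          ((((tp i - ∑ j ∈ I, w j * tp j : ℝ)) : ℂ) * (qt i k - ((κ i : ℝ) : ℂ) * et k - Ct k) +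
            (((U i - ∑ j ∈ I, w j * U j : ℝ)) : ℂ) * (qU i k - ((κ i : ℝ) : ℂ) * eU k - CU k))‖ ≤
        ∑ i ∈ I, ‖((w i : ℝ) : ℂ) *
          ((((tp i - ∑ j ∈ I, w j * tp j : ℝ)) : ℂ) * (qt i k - ((κ i : ℝ) : ℂ) * et k - Ct k) +
            (((U i - ∑ j ∈ I, w j * U j : ℝ)) : ℂ) * (qU i k - ((κ i : ℝ) : ℂ) * eU k - CU k))‖ :=
          norm_sum_le _ _
      _ ≤ ∑ i ∈ I, (w i * (|tp i - ∑ j ∈ I, w j * tp j| * rt k) +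
            w i * (|U i - ∑ j ∈ I, w j * U j| * rU k)) := by
          refine Finset.sum_le_sum fun i hi => ?_
          rw [norm_mul, Complex.norm_real, Real.norm_of_nonneg (hw0 i hi), ← mul_add]
          refine mul_le_mul_of_nonneg_left ((norm_add_le _ _).trans (add_le_add ?_ ?_)) (hw0 i hi)
          · rw [norm_mul, Complex.norm_real, Real.norm_eq_abs]
            exact mul_le_mul_of_nonneg_left (hrt i hi k hk) (abs_nonneg _)
          · rw [norm_mul, Complex.norm_real, Real.norm_eq_abs]
            exact mul_le_mul_of_nonneg_left (hrU i hi k hk) (abs_nonneg _)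
      _ = (∑ i ∈ I, w i * |tp i - ∑ j ∈ I, w j * tp j|) * rt k +
            (∑ i ∈ I, w i * |U i - ∑ j ∈ I, w j * U j|) * rU k := by
          rw [Finset.sum_add_distrib, Finset.sum_mul, Finset.sum_mul]
          congr 1 <;> exact Finset.sum_congr rfl fun i _ => by ring
      _ ≤ (βt - αt) / 2 * rt k + (βU - αU) / 2 * rU k :=
          add_le_add (mul_le_mul_of_nonneg_right hmadt hrt0) (mul_le_mul_of_nonneg_right hmadU hrU0)
  have h2 : ∑ k ∈ wd, ‖∑ i ∈ I, ((w i : ℝ) : ℂ) *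
        ((((tp i - ∑ j ∈ I, w j * tp j : ℝ)) : ℂ) * (qt i k - ((κ i : ℝ) : ℂ) * et k) +
          (((U i - ∑ j ∈ I, w j * U j : ℝ)) : ℂ) * (qU i k - ((κ i : ℝ) : ℂ) * eU k))‖ ≤
      (βt - αt) / 2 * ∑ k ∈ wd, rt k + (βU - αU) / 2 * ∑ k ∈ wd, rU k :=
    (Finset.sum_le_sum hRn).trans (le_of_eq (by rw [Finset.sum_add_distrib, Finset.mul_sum, Finset.mul_sum]))
  linarith

/-! ### §5 Prescribed-target (`_at`) forms -/

/-- Prescribed-target form of `…_combination_TT'_ineq_weighted`: the barycentre is NAMED `(t, tp', U')`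
(hypotheses `Σ wᵢ t'ᵢ = tp'`, `Σ wᵢ Uᵢ = U'`), as a COMBINE emission at a named rational θ states it. [cite: WangEtAl2024, §III] -/
theorem InfVolFermionState.IsTorusLimitOf.re_expect_ge_of_window_certificates_combination_TT'_ineq_weighted_at
    (t : ℝ) {ι₀ : Type*} (I : Finset ι₀) (w : ι₀ → ℝ) (hw0 : ∀ i ∈ I, 0 ≤ w i)
    (hw1 : ∑ i ∈ I, w i = 1) (tp U u c κ : ι₀ → ℝ)
    (tp' U' : ℝ) (htp : ∑ i ∈ I, w i * tp i = tp') (hUU : ∑ i ∈ I, w i * U i = U') (hU : ∀ i ∈ I, 0 ≤ U i)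
    (hκ : ∀ i ∈ I, 0 ≤ κ i) {n : ℝ} (hn0 : 0 ≤ n) (hn2 : n < 2) {u' : ℝ}
    (hu : ThermodynamicLimit.energyDensityTT' t tp' U' n ≤ u')
    {Λ Λ' : Finset (Site 2)} (hΛ : Λ ⊆ Λ') (h8 : thicken Λ 1 ⊆ Λ')
    (h0 : thicken ({0} : Finset (Site 2)) 1 ⊆ Λ') (hz : (0 : Site 2) ∈ Λ')
    (Xw : FermionOp Λ') (μ : ι₀ → Fin 2 → ℝ) (ν : ℝ)
    {m : Type*} [Fintype m] [DecidableEq m] (Λm : ι₀ → Matrix m m ℂ)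
    (hΛm : ∀ i ∈ I, (Λm i).PosSemidef) (O : m → FermionOp Λ')
    {κ' : Type*} (s : Finset κ') (B : ι₀ → κ' → FermionOp Λ)
    {ι : Type*} (tt : Finset ι) (γ : ι → DihedralGroup 4) (hγ1 : ∀ l ∈ tt, γ l = 1) (wv : ι → Site 2)
    (hsh : ∀ l, d4ShiftSet (γ l) (wv l) Λ ⊆ Λ') (Y : ι₀ → ι → FermionOp Λ)
    {ρ : Type*} (uu : Finset ρ) (b : ι₀ → ρ → ℂ) (cw : ρ → List (Orb (PolySite Λ') × Bool))
    (hcw : ∀ j ∈ uu, ladderCharge (cw j) ≠ 0 ∨ ladderSpinCharge (cw j) ≠ 0)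
    {δ : Type*} (ah : Finset δ) (dc : ι₀ → δ → ℝ) (V : δ → FermionOp Λ')
    {κ'' : Type*} (wd : Finset κ'') (a : ι₀ → κ'' → ℂ)
    (word : κ'' → List (Orb (PolySite Λ') × Bool))
    (qt qU : ι₀ → κ'' → ℂ) (et eU : κ'' → ℂ)
    (hqt : ∀ i ∈ I, ∑ k ∈ s, ((hubbardTTPrimeFermionInteraction 0 1 0).localHamiltonian Λ' *
          fermionEmbed (PolySite.incl hΛ) (B i k) -
        fermionEmbed (PolySite.incl hΛ) (B i k) *
          (hubbardTTPrimeFermionInteraction 0 1 0).localHamiltonian Λ') =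
      ∑ k ∈ wd, qt i k • ladderWord (word k))
    (hqU : ∀ i ∈ I, ∑ k ∈ s, ((hubbardTTPrimeFermionInteraction 0 0 1).localHamiltonian Λ' *
          fermionEmbed (PolySite.incl hΛ) (B i k) -
        fermionEmbed (PolySite.incl hΛ) (B i k) *
          (hubbardTTPrimeFermionInteraction 0 0 1).localHamiltonian Λ') =
      ∑ k ∈ wd, qU i k • ladderWord (word k))
    (het : fermionEmbed (PolySite.incl h0) ((hubbardTTPrimeFermionInteraction 0 1 0).meanEnergyObs 1) =
      ∑ k ∈ wd, et k • ladderWord (word k))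
    (heU : fermionEmbed (PolySite.incl h0) ((hubbardTTPrimeFermionInteraction 0 0 1).meanEnergyObs 1) =
      ∑ k ∈ wd, eU k • ladderWord (word k))
    (hcert : ∀ i ∈ I, Xw - ((c i : ℝ) : ℂ) • (1 : FermionOp Λ') -
        ∑ σ : Fin 2, ((μ i σ : ℝ) : ℂ) • (nAt 0 hz σ - ((ν : ℝ) : ℂ) • (1 : FermionOp Λ')) -
        ((κ i : ℝ) : ℂ) • (((u i : ℝ) : ℂ) • (1 : FermionOp Λ') -
          fermionEmbed (PolySite.incl h0)
            ((hubbardTTPrimeFermionInteraction t (tp i) (U i)).meanEnergyObs 1)) =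
      gramForm (Λm i) O +
        (∑ k ∈ s, ((hubbardTTPrimeFermionInteraction t (tp i) (U i)).localHamiltonian Λ' *
              fermionEmbed (PolySite.incl hΛ) (B i k) -
            fermionEmbed (PolySite.incl hΛ) (B i k) *
              (hubbardTTPrimeFermionInteraction t (tp i) (U i)).localHamiltonian Λ') +
          ∑ l ∈ tt, (fermionEmbed (PolySite.incl (hsh l))
              (fermionEmbed (PolySite.d4Emb (γ l) (wv l) Λ) (Y i l)) -
            fermionEmbed (PolySite.incl hΛ) (Y i l)) +
          ∑ j ∈ uu, b i j • ladderWord (cw j)) +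
        (∑ m' ∈ ah, ((dc i m' : ℝ) : ℂ) • ((V m')ᴴ - V m') + ∑ k ∈ wd, a i k • ladderWord (word k)))
    {Ls : ℕ → ℕ} (hLs : Tendsto Ls atTop atTop)
    {ψ : ∀ L, Fock (Orb (FermionTorus 2 L))}
    (hψ : ∀ j, IsGroundStateInSector
      (hubbardTorusTT' (Ls j) t tp' U')
      (ThermodynamicLimit.rectN n (Ls j)) 0 (ψ (Ls j)))
    (hψ1 : ∀ j, star (ψ (Ls j)) ⬝ᵥ ψ (Ls j) = 1)
    {ω : InfVolFermionState 2} (hω : ω.IsTorusLimitOf ψ Ls) :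
    ∑ i ∈ I, w i * (c i - ∑ k ∈ wd, ‖a i k‖ + (∑ σ : Fin 2, μ i σ) * (n / 2 - ν)) +
        (∑ i ∈ I, w i * (κ i * u i) - (∑ i ∈ I, w i * κ i) * u') -
        ∑ k ∈ wd, ‖∑ i ∈ I, ((w i : ℝ) : ℂ) *
            ((((tp i - tp' : ℝ)) : ℂ) * (qt i k - ((κ i : ℝ) : ℂ) * et k) +
              (((U i - U' : ℝ)) : ℂ) * (qU i k - ((κ i : ℝ) : ℂ) * eU k))‖ ≤
      (ω.expect Λ' Xw).re := by
  subst htp hUU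
  exact hω.re_expect_ge_of_window_certificates_combination_TT'_ineq_weighted t I w hw0 hw1 tp U u c κ hU hκ hn0 hn2 hu hΛ h8 h0 hz Xw μ ν Λm hΛm O s B tt γ hγ1 wv hsh Y uu b cw hcw ah dc V wd a word
    qt qU et eU hqt hqU het heU hcert hLs hψ hψ1

/-- Prescribed-target form of the CELL FLOOR `…_cellFloor_of_window_certificates_TT'_ineq`: the point of the hull
is NAMED `(t, tp', U')` with `Σ wᵢ t'ᵢ = tp'`, `Σ wᵢ Uᵢ = U'` — the form a '∀θ ∈ cell' claim instantiates at each θ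
(exhibit any convex weights with that barycentre). [cite: WangEtAl2024, §III] -/
theorem InfVolFermionState.IsTorusLimitOf.re_expect_ge_cellFloor_of_window_certificates_TT'_ineq_at
    (t : ℝ) {ι₀ : Type*} (I : Finset ι₀) (w : ι₀ → ℝ) (hw0 : ∀ i ∈ I, 0 ≤ w i)
    (hw1 : ∑ i ∈ I, w i = 1) (tp U u c κ M : ι₀ → ℝ)
    (tp' U' : ℝ) (htp : ∑ i ∈ I, w i * tp i = tp') (hUU : ∑ i ∈ I, w i * U i = U') (hU : ∀ i ∈ I, 0 ≤ U i)
    (hκ : ∀ i ∈ I, 0 ≤ κ i) {n : ℝ} (hn0 : 0 ≤ n) (hn2 : n < 2)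
    (hu : ThermodynamicLimit.energyDensityTT' t tp' U' n ≤
      ∑ i ∈ I, w i * M i)
    {Λ Λ' : Finset (Site 2)} (hΛ : Λ ⊆ Λ') (h8 : thicken Λ 1 ⊆ Λ')
    (h0 : thicken ({0} : Finset (Site 2)) 1 ⊆ Λ') (hz : (0 : Site 2) ∈ Λ')
    (Xw : FermionOp Λ') (μ : ι₀ → Fin 2 → ℝ) (ν : ℝ)
    {m : Type*} [Fintype m] [DecidableEq m] (Λm : ι₀ → Matrix m m ℂ)
    (hΛm : ∀ i ∈ I, (Λm i).PosSemidef) (O : m → FermionOp Λ')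
    {κ' : Type*} (s : Finset κ') (B : ι₀ → κ' → FermionOp Λ)
    {ι : Type*} (tt : Finset ι) (γ : ι → DihedralGroup 4) (hγ1 : ∀ l ∈ tt, γ l = 1) (wv : ι → Site 2)
    (hsh : ∀ l, d4ShiftSet (γ l) (wv l) Λ ⊆ Λ') (Y : ι₀ → ι → FermionOp Λ)
    {ρ : Type*} (uu : Finset ρ) (b : ι₀ → ρ → ℂ) (cw : ρ → List (Orb (PolySite Λ') × Bool))
    (hcw : ∀ j ∈ uu, ladderCharge (cw j) ≠ 0 ∨ ladderSpinCharge (cw j) ≠ 0)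
    {δ : Type*} (ah : Finset δ) (dc : ι₀ → δ → ℝ) (V : δ → FermionOp Λ')
    {κ'' : Type*} (wd : Finset κ'') (a : ι₀ → κ'' → ℂ)
    (word : κ'' → List (Orb (PolySite Λ') × Bool))
    (qt qU : ι₀ → κ'' → ℂ) (et eU : κ'' → ℂ)
    (hqt : ∀ i ∈ I, ∑ k ∈ s, ((hubbardTTPrimeFermionInteraction 0 1 0).localHamiltonian Λ' *
          fermionEmbed (PolySite.incl hΛ) (B i k) -
        fermionEmbed (PolySite.incl hΛ) (B i k) *
          (hubbardTTPrimeFermionInteraction 0 1 0).localHamiltonian Λ') =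
      ∑ k ∈ wd, qt i k • ladderWord (word k))
    (hqU : ∀ i ∈ I, ∑ k ∈ s, ((hubbardTTPrimeFermionInteraction 0 0 1).localHamiltonian Λ' *
          fermionEmbed (PolySite.incl hΛ) (B i k) -
        fermionEmbed (PolySite.incl hΛ) (B i k) *
          (hubbardTTPrimeFermionInteraction 0 0 1).localHamiltonian Λ') =
      ∑ k ∈ wd, qU i k • ladderWord (word k))
    (het : fermionEmbed (PolySite.incl h0) ((hubbardTTPrimeFermionInteraction 0 1 0).meanEnergyObs 1) =
      ∑ k ∈ wd, et k • ladderWord (word k))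
    (heU : fermionEmbed (PolySite.incl h0) ((hubbardTTPrimeFermionInteraction 0 0 1).meanEnergyObs 1) =
      ∑ k ∈ wd, eU k • ladderWord (word k))
    (hcert : ∀ i ∈ I, Xw - ((c i : ℝ) : ℂ) • (1 : FermionOp Λ') -
        ∑ σ : Fin 2, ((μ i σ : ℝ) : ℂ) • (nAt 0 hz σ - ((ν : ℝ) : ℂ) • (1 : FermionOp Λ')) -
        ((κ i : ℝ) : ℂ) • (((u i : ℝ) : ℂ) • (1 : FermionOp Λ') -
          fermionEmbed (PolySite.incl h0)
            ((hubbardTTPrimeFermionInteraction t (tp i) (U i)).meanEnergyObs 1)) =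
      gramForm (Λm i) O +
        (∑ k ∈ s, ((hubbardTTPrimeFermionInteraction t (tp i) (U i)).localHamiltonian Λ' *
              fermionEmbed (PolySite.incl hΛ) (B i k) -
            fermionEmbed (PolySite.incl hΛ) (B i k) *
              (hubbardTTPrimeFermionInteraction t (tp i) (U i)).localHamiltonian Λ') +
          ∑ l ∈ tt, (fermionEmbed (PolySite.incl (hsh l))
              (fermionEmbed (PolySite.d4Emb (γ l) (wv l) Λ) (Y i l)) -
            fermionEmbed (PolySite.incl hΛ) (Y i l)) +
          ∑ j ∈ uu, b i j • ladderWord (cw j)) +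
        (∑ m' ∈ ah, ((dc i m' : ℝ) : ℂ) • ((V m')ᴴ - V m') + ∑ k ∈ wd, a i k • ladderWord (word k)))
    {F : ℝ} (hF : ∀ i ∈ I, F ≤ c i - ∑ k ∈ wd, ‖a i k‖ + (∑ σ : Fin 2, μ i σ) * (n / 2 - ν) -
      κ i * (M i - u i))
    {kref rκ : ℝ} (hkr : ∀ i ∈ I, |κ i - kref| ≤ rκ)
    {αM βM : ℝ} (hMr : ∀ i ∈ I, αM ≤ M i ∧ M i ≤ βM)
    {αt βt : ℝ} (htr : ∀ i ∈ I, αt ≤ tp i ∧ tp i ≤ βt)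
    {αU βU : ℝ} (hUr : ∀ i ∈ I, αU ≤ U i ∧ U i ≤ βU)
    (Ct CU : κ'' → ℂ) (rt rU : κ'' → ℝ)
    (hrt : ∀ i ∈ I, ∀ k ∈ wd, ‖qt i k - ((κ i : ℝ) : ℂ) * et k - Ct k‖ ≤ rt k)
    (hrU : ∀ i ∈ I, ∀ k ∈ wd, ‖qU i k - ((κ i : ℝ) : ℂ) * eU k - CU k‖ ≤ rU k)
    {Ls : ℕ → ℕ} (hLs : Tendsto Ls atTop atTop)
    {ψ : ∀ L, Fock (Orb (FermionTorus 2 L))}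
    (hψ : ∀ j, IsGroundStateInSector
      (hubbardTorusTT' (Ls j) t tp' U')
      (ThermodynamicLimit.rectN n (Ls j)) 0 (ψ (Ls j)))
    (hψ1 : ∀ j, star (ψ (Ls j)) ⬝ᵥ ψ (Ls j) = 1)
    {ω : InfVolFermionState 2} (hω : ω.IsTorusLimitOf ψ Ls) :
    F - rκ * ((βM - αM) / 2) - ((βt - αt) / 2 * ∑ k ∈ wd, rt k + (βU - αU) / 2 * ∑ k ∈ wd, rU k) ≤
      (ω.expect Λ' Xw).re := by
  subst htp hUU
  exact hω.re_expect_ge_cellFloor_of_window_certificates_TT'_ineq t I w hw0 hw1 tp U u c κ M hU hκ hn0 hn2 hu hΛ h8 h0 hz Xw μ ν Λm hΛm O s B tt γ hγ1 wv hsh Y uu b cw hcw ah dc V wd a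
    word qt qU et eU hqt hqU het heU hcert hF hkr hMr htr hUr Ct CU rt rU hrt hrU hLs hψ hψ1

end Literature.MathematicalPhysics.QuantumLattice

end
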